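import Mathlib
import Summits.HodgeConjecture.HodgeConjecture.Theses.PadicSemiregularLift
import Summits.HodgeConjecture.HodgeConjecture.Cruxes.SemiregularSeedsOnAnchors.TypedCrux
import Literature.AlgebraicGeometry.HodgeTheory.SemiregularityMap
import Literature.AlgebraicGeometry.Modules.TensorProduct
import Literature.AlgebraicGeometry.Deformation.VectorBundleLifting

/-!
# Disproof of `SemiregularSeedsOnAnchors` (crux `stmt-HodgeConjecture-13941`, route `PadicSemiregularLift`) — findings

Standing adversary's work file (refuter `cdisprove`, cycle 1, 2026-08-15; EXTENDED in cycle 2 and cycle 3, 2026-08-16 — see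
"Cycle 2 findings" and "Cycle 3 findings" below the cycle-1 index). The crux is INFORMAL (no
route decl; `signature: null`), so no `¬ Crux` theorem can be typed; this file records (i) what IS
checkable in Lean over the tree's only σ-carrier `Literature.AlgebraicGeometry.HodgeTheory.AtiyahTraceAlgebra`,
and (ii) the paper attacks, as docstrings next to the Lean shadow they justify. VERDICT OF CYCLE 1:
**no kill**; the crux survives every cheap attack, for the reasons in §F — and the disprover's own
forced-kernel computation on the natural family at the route's first test (§E) turned up a plausible
COHERENT seed (`𝓘_Z`, `Z` the two-point incidence surface in `S × Ŝ`, `K = ℚ(√−3)`), i.e. evidence FOR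
the coherent variant there; the locally-free variant is untouched. Prior attacks read and used:
CRUX-ATTACK.md (g0) and CRUX-ATTACK-g2.md (g2) via their item notes (the evidence files themselves
are gate-side only): degenerate `r`, restates-target, (a)/(b) load-bearing, forced family
`Φ = ⟨1,θ,θ²,w₊,w₋,θ³,pt⟩`, `ρ₂ ≤ 24`, Fermat plane bundles `E_P`. Nothing below repeats them except
where a claim of theirs is given a proof (§D2) or a Lean shadow (§A′, §B).

## Index of findings

* §A  (section `Redecoration`, CHECKED) — TYPING. Over `AtiyahTraceAlgebra` the trace, product and
  Atiyah class are free data: `killTrace` makes ANY algebra non-semiregular as soon as `Ext² ≠ 0`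
  (`not_isSemiregular_killTrace`), `tautological S` makes an algebra with `Ext² = S` arbitrarily large
  semiregular (`isSemiregular_tautological`). Hence a closed typing "∃ seeds Eᵢ with IsSemiregular (D Eᵢ)"
  is VACUOUS if the decoration `D` is ∃-quantified and REFUTABLE if ∀-quantified: the crux can only be
  typed over a CONSTRUCTED Atiyah class + Illusie trace (the planner's filed definition requests), exactly
  as g2 said; these two theorems are the witnesses.
* §A′ (section `TransposeCriterion`, CHECKED) — the linear algebra of g2's Lemma B / Markman
  arXiv:2502.03415 Lemma 8.3.4 + Rem. 8.3.5: if `σ = evᵗ ∘ (Serre duality)` then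
  `σ injective ⇔ ev surjective ⇔ dim Ext² = rank(σ ∘ ev)`, and `σ ∘ ev = ⌟ch(E)` (BF Prop. 4.2) is a
  matrix in `ch(E)` alone. On abelian FOURFOLDS (ω trivial, `(HΩ₋₂)^∨ = HT²`) this makes
  "semiregular ⇔ ext²(E,E) = ρ₂(ch E)" exact; on a cubic fourfold the dual of `σ₁` is
  `η₀ ↦ η₀ ∧ At(E)`, `η₀ ∈ H¹(Ω³) = H¹(T ⊗ ω)` (§C). On abelian SIXFOLDS it is NOT exact
  (`(HΩ₋₂)^∨ = HT⁴`), which is why Markman checks surjectivity of `ev` by hand there.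
* §B  (section `ForcedKernel`, CHECKED) — `finrank_ext_le_of_isSemiregular`: semiregular ⇒
  `dim Ext²(E,E) ≤ Σ_{q∈S} h^{q,q+2}` once the other components vanish; contrapositive
  `not_isSemiregular_of_lt_finrank_ext`. Every forced-kernel attack is an instance.
* §C  (section `CubicFourfold`, CHECKED arithmetic + criterion) — NEW ANCHOR CLASS EXAMINED: supersingular
  cubic fourfolds (`p ≡ 2 (3)`, `p ≥ 11`) are anchors with the SMALLEST possible target,
  `τ = h^{1,3} = 1` (`cubicFourfold_hodgeNumbers`), so seeds have `ext²(E,E) ≤ 1`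
  (`cubicFourfold_finrank_ext_le_one`) and, when `ext² = 1`, semiregular ⇔ `σ₁ ≠ 0`
  (`cubicFourfold_isSemiregular_iff`). Paper consequences (doc of that section): `Ext² = 0 ⇒ ch₂ ∈ ℚh²`
  (Baire + étale p-adic period map), so every useful seed has `ext² = 1` EXACTLY; every simple object of
  the Kuznetsov component `𝒜_{X_k}` has `ext² = hom = 1` (Serre functor `[2]`, characteristic-free) and is
  semiregular as soon as its Hodge class `ch₂^{Hdg} ∉ k·h²` — so the COHERENT/complex variant is richly
  supplied and a forced kernel can at best bite on LOCAL FREENESS or on "sheaf vs complex"; Hodge-origin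
  classes = algebraic classes of `X_K` (Zucker's HC for cubic fourfolds + a p-adic Lefschetz-(2,2) via
  Berthelot–Ogus on the Fano variety of lines). No kill: classifying `ext² = 1` bundles with prescribed
  non-Lefschetz `ch₂` on a supersingular cubic fourfold is open; the one new NECESSARY condition found
  ("invisible" lifts force `ev ≡ 0` on `H¹(T_{X_k})`) is not contradictory.
* §D  (section `WithoutHodgeOrigin`, CHECKED count; section `WeilAnchor` docs) — WEIL `E⁴`-ANCHOR (kill
  criterion (b)). D1: g2's "(b) is load-bearing" count `70 − 2·17 = 36 > 3` as rank–nullity.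
  D2 (NEW, proof in `WeilAnchor`): NO Mukai vector of the shape `r₁e^{d₁} + r₂e^{d₂}` (`rᵢ ≠ 0`,
  `dᵢ ∈ NS(X_k)_ℚ`) satisfies the Hodge conditions with non-zero Weil component — this settles g2's
  "split L₁ ⊕ L₂ never reaches the Weil plane" with a proof and extends it to extensions/kernels of two
  semi-homogeneous bundles; the obstruction is CLASS-level. D3 (NEW): the untwisting trick
  `E ↦ End E = E ⊗ E^∨` (always untwisted, `ch = κκ^∨`, full Hodge condition automatic, Weil component
  `2κ₂ ≠ 0`) runs into §B: on an abelian fourfold `ext²(End E) ≥ 6 + 2(ext²(E) − 6) + 6`, so `End E`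
  semiregular needs `ext²(E,E) ≤ 12` — `E` itself nearly semi-homogeneous. D4 (NEW): the supersingular
  jump `NS: 1 → 28` does NOT untwist Markman's `μ_r`-twisted `B` on the special fibre: although
  `Br(X_k)[r] = 0` for `p ∤ r` (`NS/r ≅ H²(X_k, μ_r)` as `b₂ = ρ = 28`), the specialisation map
  `NS(X_K̄) → NS(X_k)` has cokernel without `r`-torsion for `p ∤ r` (a polarisation `λ` with
  `λ_k = rμ_k` kills the étale `A[r]` already over `W`), so `c₁(Ē) ≡ m·h (mod r)` holds on `X_k` iff it
  holds in characteristic 0. D5: the Weil classes are Hodge-VISIBLE on `X_k` (their de Rham realisations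
  `ē₂¹ē₂²ē₁³ē₁⁴`, `ē₁¹ē₁²ē₂³ē₂⁴` in the Dieudonné basis `Fe₁ = e₂, Fe₂ = ±pe₁` are non-zero of type
  `(2,2)`; `φ` swaps `ŵ₊, ŵ₋` with valuation exactly `p²`, so rational Weil classes have unit
  coordinates on both), and `θ` is visible, so g2's `ρ₂ ≤ 24` on `Φ` is the correct SPECIAL-fibre value
  (no hidden drop, no hidden rescue); but `NS(X_k) ⊗ k → H¹(Ω¹)` has a 12-dimensional kernel (6 classes
  die in `H²_dR`, 6 land in `H⁰(Ω²)`), which lowers `ρ₂` for seeds built from special-fibre-only divisor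
  classes (e.g. Orlov images of sheaves on `E²_ss`, §E).
* §E  THE NATURAL FAMILY AT THE WEIL ANCHOR, COMPUTED BY HAND (new; details in section `WeilAnchor`,
  docstring `secant_fourfold_ext2_count` and the `/-! §E′ -/` block). Markman's `n = 2` secant data ON
  THE SPECIAL FIBRE: `X_k = S × Ŝ`, `S = E²_ss`, `F₁ = 𝓘_x`, `F₂ = L ⊗ 𝓘_y` with `L` a principal
  polarisation (`v₁ = (1,0,−1)`, `v₂ = (1,ℓ,0)`, `vᵢ² = 2`, `(v₁^∨,v₂) = 1`: the plane `P` is POSITIVE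
  definite for the standard Mukai pairing = "negative definite" in Markman's sign, the `n = 2` Weil-type
  case of arXiv:2502.03415 p. 4 / arXiv:1805.11574, `K = ℚ(√−3)`, so `p ≡ 2 (3)`). RESULT: the object
  `F₁^∨ ⊠ F₂ ∈ D^b(S_k × S_k)` IS SEMIREGULAR — `ext² = 1 + 4·4 + 1 = 18`, `ev` surjective, and the
  contraction rank is `ρ⁰ρ² + ρ¹ρ¹ + ρ²ρ⁰ = 1 + 16 + 1 = 18` because `ρ¹(u) = rank [[r·I, Mᵗ],[M R, s·J]] = 4`
  for `u = (r, M = ℓ^{Hdg}, s)` exactly when `rs ≠ det M`-type non-degeneracy holds (`v₁^∨`: `r = 1`,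
  `s = −1`, `M = 0`; `v₂`: `r = 1`, `s = 0`, `M =` identity, VISIBLE) — in every characteristic `≠ 2, 3`,
  special fibre included (D5 is used: had `ℓ` been one of the 2 invisible classes of `NS(E²_ss)`, `ρ¹`
  would drop to 2 and the kernel would be forced). By Markman Lemma 8.3.4 + derived invariance its Orlov
  image on the `ℚ(√−3)`-Weil fourfold `S_k × Ŝ_k` is a semiregular OBJECT `G` whose class has non-zero
  Hodge–Weil component (Prop. 1.2.1 loc. cit.), and — following §9.2 loc. cit. with `n = 2` —
  `G ≃ G₁[−1]` is a SHEAF up to shift: `G_k = R^kπ₂₃,*(π₁^*𝓘_x ⊗ 𝓕₂)` has fibres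
  `H^k(S, L_{λ} ⊗ 𝓘_x ⊗ 𝓘_{y−y'})`, so `G₀ = 0` (torsion-free, generically zero), `G₂ = 0`
  (`H²(L_λ ⊗ 𝓘) = H²(L_λ) = 0`), and `G₁` is torsion-free of rank `−χ = 2 − ℓ²/2 = 1`, dropping rank
  along the codimension-2 "two-point incidence surface" `Z = {(y',ζ) : x, y − y' ∈ Θ_{λ(y',ζ)}}`
  (fibred over the theta curve `Θ̂_x` with fibres `Θ_λ`; birational to `C × C` when `S = Jac C`), whence
  (Hilbert–Burch) `G₁ ≅ N ⊗ 𝓘_Z`. CONSEQUENCE (the disprover's main positive finding, handed to the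
  provers): **`𝓘_Z` is a rank-one, untwisted (`c₁ = 0`), semiregular coherent sheaf on the anchor whose
  `ch = κ(G)` lies in the generic Hodge ring `Φ` of the Weil family in ALL degrees (Spin-invariance of
  `κ`, Markman Cor. "κ-class is Spin(V)_P-invariant") and whose `ch₂ = −[Z]` has non-zero Weil part** —
  i.e. a candidate seed for the COHERENT variant of the crux at its own first test, pending three checks
  the disprover could not do on paper: (α) the anchor `(S_k × Ŝ_k, η_P(√−3), h_P)` has tangent signature
  `(2,2)` and unramified Weil lifts (automatic in char 0 from "P spanned by Hodge classes"; on `S_k`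
  every class is algebraic, so choose `S_k`, `P` as reductions of a CM point); (β) the `K`-span of
  `ch₂(𝓘_Z)` over the finitely many choices (`(F₁,F₂) ↔ (F₂,F₁)`, Rem. 9.2.3; phases of `v₁^∨ ⊗ v₂` in
  `ℓ̃ᵢ ⊗ ℓ̃ⱼ`) covers BOTH rational Weil directions mod `θ²`; (γ) `Z` has the expected codimension and
  `G₁` is torsion-free on the supersingular fibre (generic-translate arguments in char `p`). WHAT THIS
  FAMILY CANNOT DO (forced kernels, proved by the counts here): (1) no LOCALLY FREE seed — `ext² = 18`
  forces `vᵢ² = 2`, positivity of `P` forces `|(v₁^∨,v₂)| ≤ 1`, so `rank = |(v₁^∨,v₂)| ≤ 1`; (2) no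
  torsion-free seed for `K ≠ ℚ(√−3)` — Gram `[[2,±1],[±1,2]]` has discriminant 3; `b = 0` (`K = ℚ(i)`)
  gives rank 0 (torsion avatars only); larger `vᵢ²` gives `ext² ≥ 2 + 4·6 = 26 > 24`; (3) the one-sheaf
  plane of 1805.11574 (`F₁ = F₂ = F`, `v(F) = (1,ℓ,−1)`, `v² = 4`, Gram `diag(4,4)`, `K = ℚ(i)`) has
  `ext²(E,E) = 1 + 36 + 1 = 38 > 24`: forced kernel — consistent with Markman deforming that `E` by
  hyper-Kähler methods, not semiregularity. So: the locally-free crux is untouched by the natural family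
  (neither killed nor confirmed), the coherent crux is plausibly CONFIRMED at `K = ℚ(√−3)` anchors by
  `𝓘_Z`, and a forced-kernel kill of the coherent crux would have to beat `𝓘_Z` — it cannot.
* §F  WHY IT RESISTS (for provers). Any kill is a CLASSIFICATION statement — "every locally free (and
  every coherent) `E` on `E⁴_ss` with `ch E ∈ Φ_ℚ`, Weil part `≠ 0`, has `ext²(E,E) > ρ₂(ch E)`" (resp.
  `ext² ≥ 2` on the cubic fourfold) — and no numerical invariant separates the two sides: (1) χ-parity and
  the simple-seed inequality `χ ≤ ρ₂ − 14` are satisfiable (g2); (2) class-level constraints vanish for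
  Mukai vectors with ≥ 5 exponential terms (dimension count `116 > 94`) and for general `K`-classes
  (`ch : K₀(X_k)_ℚ → ⊕N^r_ℚ` is onto; Milne: divisors generate all algebraic classes of `E⁴_ss`); only
  `≤ 2` terms are excluded (D2); (3) the Brauer obstruction is absent on `X_k` (D4) but so is the extra
  room it seemed to give; (4) on cubic-fourfold anchors the Kuznetsov component supplies COMPLEXES with
  exactly the required `ext² = 1` and visible `ch₂`, so a forced kernel must distinguish sheaves from
  complexes; (5) semiregularity is invariant under derived autoequivalences (Markman p. 48: `ext²` and
  `rank ev` are), and `Aut D^b(X_k)` is huge for `X_k` supersingular, so any forced-kernel proof must be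
  autoequivalence-invariant — it cannot be a statement about vector bundles alone unless local freeness
  is where it bites (the planner's restate clause then applies).
  Literature checked this cycle (arXiv only; searchd/OpenAlex/S2 degraded): Markman arXiv:2502.03415
  (Thm 1.4.1, 1.5.1: semiregular REFLEXIVE `Ē` on special Weil sixfolds `(J×Ĵ)/Ḡ`, twisted `B` for the
  deformation; Cor. 1.6.1: HC for abelian FOURFOLDS is now a theorem; Lemma 8.3.4/Rem 8.3.5; derived
  invariance p. 48; p. 45: `ext²(F_d,F_d) = 8d + 2ext¹ − 2` grows with `d` — Markman's own forced
  kernel), arXiv:2509.23403 and arXiv:2509.23079 (real-multiplication generalisation; nothing on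
  fourfold seeds or characteristic `p`), Floccari–Fu arXiv:2504.13607 (Weil fourfolds disc 1 via OG6).
  No printed counterexample or obstruction to p-adic semiregular seeds exists; the notion is the route's.

## Cycle 2 findings (refuter-cdisprove-…-13941-g2-0, 2026-08-16; sections `CycleTwo…` below, all CHECKED)

Inputs read this cycle: the six crux idea cards (Ideas/), TRIAGE-r1-{1,2,3}, Ideator{One,Three}Notes,
the item notes; no line picked yet (no PICKED.md, `targets = []`). VERDICT OF CYCLE 2: **no kill**, but the
map of where the crux is exposed has changed, and the leading line's ℚ(i) branch is dead on its own test.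

* §G1 (section `CycleTwo_Transport`) — THE TWO VARIANTS COINCIDE AT ABELIAN ANCHORS. Semiregularity is
  transported along any intertwiner of the σ-data (`isSemiregular_transport`: `e : Ext² ≃ Ext²`,
  injective `g_k` on the targets, `σ_k^B ∘ e = g_k ∘ σ_k^A`); a derived equivalence `Φ` supplies
  exactly this (HH-functoriality, Perry Rem. 2.3; HKR for `p > dim`). Hence on a principally polarised
  abelian anchor a COHERENT seed `G` yields a LOCALLY FREE seed `Φ_𝒫(G ⊗ Θ^N)` on `X̂_k ≅ X_k`
  (`N ≫ 0` gives IT₀ uniformly in `P ∈ Pic⁰` by boundedness; Mukai: the transform of an IT₀ sheaf is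
  locally free of rank `χ`; its `ch = FM_H(ch(G)e^{NΘ})` is Hodge in all degrees because `𝒫` lives on
  `𝒳 ×_W 𝒳̂` and an algebraic correspondence respects `F^•`; on `H⁴` the transform is an isomorphism
  carrying `W_X → W_{X̂}` and `θ² ↦ ℚθ̂²`, so "Weil part ≠ 0" is kept). CONSEQUENCE: kill criterion
  (b)'s clause "killing only the locally free variant triggers the coherent restate" is moot at
  abelian anchors — the variants stand or fall together — and cycle 1's sentence "the locally-free crux
  is untouched by the natural family" is SUPERSEDED: §E's coherent candidate is (modulo Lemma B in
  char `p`) also a locally free candidate on the dual anchor.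
* §G2 (section `CycleTwo_TraceRigid`) — TRACE-RIGID OBJECTS ARE SEEDS:
  `dim Ext²(E,E) = 1 ∧ σ_k ≠ 0 for one k ⇒ semiregular` (`isSemiregular_of_finrank_ext_eq_one`,
  and with `k = 0`: `Tr ≠ 0` suffices, `…_of_trace`; e.g. `Ext²(E,E) = H²(𝒪)·id`, `p ∤ rk`). So
  every cohomologically 2-rigid sheaf is a seed FOR ITS OWN `ch₂`; a forced-kernel kill at an anchor
  must in particular exclude 2-rigid sheaves with the offending `ch₂` (ℙ-objects, O'Grady-type modular
  bundles, exceptional objects).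
* §G3 (section `CycleTwo_HilbertSquare`) — NEW ANCHOR CLASS EXAMINED: `X_k = S^{[2]}`, `S` a
  supersingular K3, `p ≥ 11` (cohomologically supersingular: `H⁴ = Sym²H²`, `b₄ = 276`, `ρ(S^{[2]}) = 23`;
  Hodge torsion-free for `p` odd — not re-verified). Target `τ = h^{0,2}+h^{1,3}+h^{2,4} = 1+21+1 = 23`
  (`hilbSquare_numbers`), but at a VERY GENERAL POLARISED lift `(𝒳, h)` the Hodge-origin classes of `H⁴`
  are `⟨h², c₂(X)⟩` (MT = SO(h^⊥)), `c₂(X)` stays Hodge on the whole 21-dimensional base, so for a seed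
  `ev` kills `ann(h) ⊂ H¹(T)` (20-dim) and every `σ`-component into `H³(Ω¹)` is proportional to `h·σ̄`:
  EFFECTIVE BUDGET `ext²(E,E) = rank ev ≤ 23 − 20 = 3` (`finrank_range_le_of_le_finrank_ker`). The class
  to be reached, `c₂(X_K) mod h²`, is ALGEBRAIC FOR FREE (a Chern class) — so this anchor tests the
  crux's "not implied by HC" content in isolation. Non-seeds: `T_X` (`ev|H¹(T) = 0`, `ext² ≥ h²(Λ²T) =
  h^{2,2} = 232`), `𝒪_x` (`ext² = 6 > ρ₂(pt) = 1`), `𝒪_P` for a Lagrangian plane (`ext² = 1`, semiregular,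
  but `[P] ∉ ⟨h²,c₂⟩` and `ch₃ = (3/2)[ℓ_P] ∉ ℚh³`: fails the Hodge condition at every polarised lift,
  `χ(𝒪_P) = 1 ⇒ ch₄ = 5/4`), line bundles (Lefschetz). WOULD-BE seeds: rigid modular bundles `F` with
  `H^*(End₀F) = 0` (O'Grady, char 0, general `(X,h)` of K3^{[2]} type): `Ext² = H²(𝒪)·id ⇒` semiregular by
  §G2, `Δ(F) ∝ c₂(X) ⇒ ch₂(F)` has a `c₂(X)`-component, `c₁ ∝ h`. Their existence on a SUPERSINGULAR
  Hilbert square is unverified — a kill here = "no 2-rigid sheaf with `Δ ∝ c₂(X)`, `c₁ ∝ h` on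
  `S_k^{[2]}`", again a classification statement. No kill.
* §G4 (section `CycleTwo_SecantAudit`; kit job `j009174`, `secant_audit.py` + `extalg.py`, exact
  arithmetic over `ℚ(√D)` in the 256-dim exterior algebras) — CLASS-LEVEL AUDIT OF THE SECANT SEEDS
  (§E, card rank-one-secant-square-seeds), independent of Markman's formulas and of g2's script:
  (i) the cohomological Orlov transform `Ψ = (1 × Φ_𝒫)∘(μ'⁻¹)^*`, `μ'(s,t) = (s−t,t)`, is verified to
  intertwine kernel conjugation (`Ad_g K`; for `⊗L`: `L⁻¹ ⊠ L ⊗ K`) with the NATURAL `so(V)`-derivation of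
  `ΛV = H^*(X)` plus a B-field (`28/28` bivectors; Markman: "Orlov categorifies Chevalley"), which is what
  makes `η_P` (triality) and `κ = ch·e^{−c₁/r}` the right invariants; (ii) `N = 1`, `K = ℚ(√−3)`
  (`F₁ = 𝓘_x`, `F₂ = L𝓘_y`, Gram `[[2,1],[1,2]]`): `ρ₂(box) = 18 = ext²` on `S×S` (Künneth factors
  `ρ¹ = 4`, `ρ² = 1`), Orlov image rank `−1`, `ρ₁ = 8`, `ρ₂ = 18` on `X` (derived invariance at class
  level ✓), `χ(G,G) = 4`; `η_P := 2ρ_spin⁻¹(J_P)` has `η_P² = −3`, is INTEGRAL on `H¹(X,ℤ)` with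
  `(1+η_P)/2` integral (`ℤ[ζ₃]` acts: the card's order-3 automorphism exists), preserves Hodge types with
  tangent signature `(2,2)` (char. poly `(x²+3)²` on `H^{1,0}`) — SETTLES (α); `Ξ_P :=` the bivector of
  `η_P` is a rational `η`-compatible `(1,1)`-class with `Ξ_P⁴ = 3456·pt`, and EXACTLY
  `κ(G) = −1 + (Ξ_P²/24 + (w₊+w₋)/3) + Ξ_P³/144 + 2·pt`: all-degree Hodge condition ✓, Weil part ≠ 0 ✓
  (role swap and `L ↦ L⁻¹` give the same `κ`); the second pair `(L𝓘_y, ι_*N)`, `N` of degree 2 on a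
  theta curve (`v = (0,ℓ,1)`, `⟨v₁,v₂⟩ = 1`), gives Weil coordinates `−(1±√−3)/6`, `K`-independent of
  `(1/3,1/3)` — SETTLES (β); generic `(ρ₁,ρ₂)` over `Φ_{η,Ξ}` is `(8,24)` (= g2), pure rational Weil
  classes have `ρ₂ = 12`, `w±` alone `6`, `Ξ²`-type `18`. So at secant-type `ℚ(√−3)` anchors the
  coherent crux — and by §G1 the locally free crux on the dual anchor — HOLD at the class + Künneth
  level; what is left is Lemma B / HKR-compatibility in characteristic `p` and sheaf bookkeeping.
  (iii) `K = ℚ(i)`, the card's rank `−2` data (`A = 3f₁+2f₂`, `B = 2f₁+f₂`, `v₁ = (1,A,5)`,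
  `v₂ = (1,B,0)`, Gram `[[2,2],[2,4]]`; NB the KERNEL carries `v₁^∨`, the PLANE is `⟨v₁,v₂⟩` — with
  `v₁^∨` in the plane one gets the indefinite Gram `[[2,−12],[−12,4]]`, `secant_discriminants`): class
  level fine (`η² = −1`, signature `(2,2)`, `κ = −2 + (Ξ²/8 + ((1∓i)/4)w±) + Ξ³/48 + pt/2 ∈ Φ`, Weil ≠ 0,
  `ρ₂ = 18`), BUT THE UNTWISTING CONGRUENCE (F2) FAILS UPSTAIRS: in `H²(X,𝔽₂) = Λ²H¹ ⊗ 𝔽₂` the odd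
  supports are `c₁(𝓔) ↦ {f₂, a₂a₂^∨, b₂b₂^∨, a₁^∨b₁^∨, a₂^∨b₂^∨}` and `Ξ_P ↦ {f₂, a₁a₁^∨, b₁b₁^∨,
  a₁^∨b₁^∨, a₂^∨b₂^∨}` (`Ξ_P` primitive), so `u·c₁(𝓔) − λΞ_P ∉ 2H²(X,ℤ)` for every odd `u` (det-twists)
  and every `λ ∈ ℤ` (`F2_parity_obstruction`, `decide`); line-bundle twists move `c₁` by `2NS`; the same
  for the role-swapped, `f₁↔f₂` and sign variants; D4 (no prime-to-`p` torsion in `coker sp`) carries the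
  failure to `X_k` and to `X'_k = X_k/Ḡ` (pull-back of an even class is even). And the rank-0 orthogonal
  `ℚ(i)` pair (`𝓘_x`, `B𝓘_y`, Gram `diag(2,2)`) has `c₁(G) = Ξ_P/2` but `ch₂(G) ∉ ℚΞ_P² ⊕ W`,
  `ch₃ ∉ ℚΞ_P³`: fails the Hodge condition in degrees 2, 3 (rank 0 cannot be untwisted). UPSHOT: at
  `ℚ(i)` (more generally `ℚ(√−m)`, `m ≡ 1,2 (4)`) Weil `E⁴`-anchors NO candidate seed from any secant
  construction on the table survives — this is where the ∀-anchor crux is most exposed, and where the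
  route's own first test (g2: `ℚ(i)`, `p ≡ 3 (4)`) now stands WITHOUT a construction.
* §G4bis THE ℚ(i) SCAN (kit job `j009762`, `qi_scan.py`; local run 578/578) — does OTHER even-rank secant
  data escape the obstruction? Model `S = E_i × E_i` (CM by `i`; supersingular reduction for `p ≡ 3 (4)`) with
  `NS(S) = ⟨f₁, f₂, [Δ]−f₁−f₂ = b₁a₂−a₁b₂, [Γ_i]−f₁−f₂ = −b₁b₂−a₁a₂⟩` (`U ⊕ ⟨−2⟩ ⊕ ⟨−2⟩`), three representatives
  `v₁ ∈ {v(𝓘_x), v(L𝓘_y), (0, f₁+f₂, 1)}`, all `v₂ = (r, D, s)` with `r ≤ 2`, NS-coordinates `≤ 2`, `|s| ≤ 4` in the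
  eight `ℚ(i)` numerical types `(v₂², ⟨v₁,v₂⟩, disc) ∈ {(2,0,4), (4,∓2,4), (8,0,16), (10,∓4,4), (10,±2,16)}`: ALL 578
  pairs give `η_P² = −1` integral, commuting with the CM complex structure, tangent signature `(2,2)`; the 213
  rank-0 images ALL fail the Hodge condition in degrees 2 and 3; the 291 rank-`±2` images are ALL class-level seeds
  (κ ∈ Φ in every degree, Weil ≠ 0) and ALL fail (F2) mod 2; the 74 rank-`±4` images are ALL class-level seeds,
  satisfy `c₁ ≡ Ξ_P (mod 2)` but ALL fail the rank-4 congruence `c₁ ≡ λΞ_P (mod 4·H²(X,ℤ))`. CONJECTURE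
  (obstruction, for a barrier-auditor): for every `ℚ(i)`-secant pair the Brauer class `c₁(𝓔)/r mod (ℤΞ_P/r + H²(X,ℤ))`
  of the Orlov image is NON-TRIVIAL — Markman's `μ_r`-gerbe is unavoidable when `disc P` is a square times 4 — so
  the secant mechanism yields NO untwisted seed at any `ℚ(i)` Weil anchor. By contrast the odd-rank members
  `N = 2` (`K = ℚ(√−7)`, `B` of type `(1,2)`) and `N = 3` (`ℚ(√−11)`) pass every class-level test
  (`sqrt7_check.py`: `η² = −7, −11`, `(1+η)/2` integral, signature `(2,2)`, `κ = −1 + Ξ²/28 + ((5∓√−7)/14)w± +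
  Ξ³/168 + 10pt` resp. `−1 + 3Ξ²/88 + ((4∓√−11)/11)w± + Ξ³/176 + 24pt`, `ρ₂ = 18` = the `Ḡ`-invariant Künneth
  count) — the `m ≡ 3 (4)` half of the card is healthy at the class level, the `m ≡ 1, 2 (4)` half has no avatar.
* §G5 ERRATUM to §E (no downstream change): the object analysed by hand in §E/§E′ is
  `Ψ(𝓘_x ⊠ L𝓘_y)` (relative Tor: the fibrewise `H⁰` jumps in codimension 2, so `G₁ ≅ N ⊗ 𝓘_Z` IS
  torsion-free), while the card's `𝓔 = Ψ(𝓘_x^∨ ⊠ L𝓘_y)` is the relative Ext (fibrewise `Hom` jumps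
  along the theta DIVISOR `D = {y − y' ∈ Θ_{L'}}`, so `𝓔[1]` is rank 1 WITH torsion along `D`); as
  `v(𝓘_x) = v(𝓘_x)^∨` both are Orlov images of semiregular box products with the same class `κ`
  (§G4), both candidate coherent seeds, and §G1 bundles either.
* §G6 WHY IT STILL RESISTS, AND WHERE A KILL COULD LIVE (for provers and for cycle 3). (1) `ℚ(i)`-type
  Weil anchors: a kill needs a PARITY THEOREM — every sheaf `E` on a disc-`≡ 0 (4)` Weil `E⁴`-anchor
  with `κ(E) ∈ Φ_{η,Ξ}`, Weil part `≠ 0`, `ext² = ρ₂(ch E)` has `c₁(E) ≢ λΞ (mod 2)` — the secant family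
  obeys it (§G4 (iii), §G4bis: 578/578 on `E_i × E_i`) but no general mechanism is known; conversely the
  provers need ONE untwisted even-rank object — not a secant image if the §G4bis conjecture holds; each further
  candidate (quaternionic graph classes on `E²_ss` need an `ℓ`-adic model) is a finite check with `qi_scan.py`. (2) Non-secant-type
  and non-superspecial supersingular Weil anchors: neither construction (χ-positivity forbids isogeny
  transport, IdeatorOne §2) nor obstruction (`ρ₂`, `χ` numerics are isogeny-invariant). (3) K3^{[2]}
  anchors: budget 3, would-be seeds = 2-rigid modular bundles on supersingular Hilbert squares
  (existence open). (4) Literature (searchd rc 75 and galaxy queue-saturated again this cycle; zbMATH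
  answered): Murty 2009 "Semiregularity and abelian varieties" (Fields Inst. Commun. 56, 293–305;
  zbl 1180.14005) is THE printed source on Bloch-semiregularity × Hodge classes on abelian varieties —
  paywalled, acq-02100 filed; Ran 1993/1999, Iacono–Manetti 2013 (CI semiregularity ⇒ g0's Fermat
  planes), Pridham 2024, BLM 2023, Lepri–Manetti 2021, Nishinou 2024: no printed counterexample to
  semiregular representability; nothing on `p`-adic semiregularity (the notion is the route's).

## Cycle 3 findings (refuter-cdisprove-…-13941-g3-0, 2026-08-16; sections `CycleThree…` / namespace `SkeletonAudit`, all CHECKED)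

**▶ KILL (late cycle 3; section `CycleThree_Kill`, paper proof `KILL.md` attached as evidence): P2a IS FALSE.** Anchor: `p ≫ 0` with
`p ≡ 5 (mod 6)`, `X_k` the Fermat sextic fourfold, `𝒳_y` a very general `W`-point of the smooth 22-dimensional `p`-adic Hodge locus
`Z` of the unsaturated rational pair class `u` (`a = (1,1,4,4,4,4)`) inside the 23-parameter monomial family invariant under
`Λ₁^⊥ ⊂ μ₆⁶/μ₆`, `Λ₁ = ⟨(0,4,2,0,0,0),(3,1,0,0,2,0),(2,0,0,0,0,4),(1,1,0,2,2,0)⟩` (order 162; ONE equation: the isotypic piece of `a`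
has exactly one `(3,1)`-character `2a`); `r = 2`, `α = bo_y(u)`: `φ`-Tate on the nose (trivially) and of Hodge origin (finite
monodromy of the orbit of `[𝒵]` along the locus + algebraic flat sections + Berthelot–Ogus on the residue disc). At `𝒳_y` the Hodge
condition confines `ch₂` of every seed to `supp ⊆ {b,b'} ∪ {c,c'}` (`c = (0,4,1,3,1,3)`), and each of the four visibility cases
contradicts semiregularity: three by monomial witness triples of the second-order obstruction (`kill_witnesses`; F2–F3 of KILL.md —
the ORDER-TWO lifting argument, valid in char `p` with no P1b input), the all-invisible case by rigidity (`Ext² = 0 ⇒` Hodge on all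
lifts `⇒ v_prim = 0`). Both the locally-free and the coherent/perfect variants die (local freeness is never used). Classification:
refuted-SUBSTANTIVE (the anchor is a generic Hodge-locus point of exactly the intended kind; all hypotheses hold verbatim; no cheap
repair: KILL.md §6). The item is informal (no decl), so no `¬D` can be landed; the planner must restate or close.


Inputs read this cycle: everything above, `TypedCrux.lean`, the three registered line skeletons
`Lines/{isogeny-untwist-superspecial, cross-ideal-orbit-transport, gorenstein-ci-seeds}.lean` (+ cards), TRIAGE-r1-*.
`targets = []`, `stuck_stubs = []`, no PICKED.md. VERDICT OF CYCLE 3: **no kill of the crux**, but (i) the first STRUCTURAL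
(non-numerical) obstruction to seeds found in three cycles — a refuted natural strengthening with a conditional kill attached —
and (ii) a skeleton audit showing that one registered line is degenerate as typed.

* §H1 (namespace `SkeletonAudit.IUS`, Lean over a VERBATIM COPY of the skeleton's definitions — the Lines module has no olean
  and cannot be imported) — LINE `isogeny-untwist-superspecial` IS DEGENERATE AS TYPED.
  (T1) `secantSiteExistence_trivial`: the registered HARDEST stub `stub_secantSite` is inhabited by the EMPTY site
  (`ι = PEmpty`, `N = 1`, `[N] = 𝟙`, `R = ⟨0, K·0^r⟩`) on every `k`-scheme, for every `C Θ Φσ` — none of the docstring's content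
  (placement, Markman transplant, level orthogonality F1, FM bundling) is a typed obligation. (T2)
  `subsingleton_ext_of_isogenyDecomposition_of_sigma_untwist_eq_zero` / `not_isogenyDecomposition_of_witness`: the LEVER stub
  quantifies over all σ-packages `Φσ` with no naturality; re-decorating the intended package to `0` on the single module
  `E′ = [N]^*Ē ⊗ M` of any site with `Ext²(Ē,Ē) ≠ 0` refutes it (under the stub such a site has `Ext²(Ē,Ē) = 0`). Corrected
  signature: hypothesis "σ commutes with isomorphisms of modules, finite étale pull-back and twists" (BF Rem. 4.7(1)), or the
  decomposition as FIELDS of the site. (T3) `inSecantScope_of_seedSpan`: for a package pinned to the real maps, EVERY witness of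
  the crux's conclusion `SeedSpan` packages into a `SecantSite` (seeds as `Ē = E″`, `N = 1`, `M = 𝒪`), so
  `InSecantScope ⊇ SeedSpan` at every `(𝒳, r, α)` of every anchor; (T3′) `residual_iff_forall_inSecantScope`: hence the registered
  RESIDUAL stub is EQUIVALENT to "every crux instance is in scope" — with the lever, to the WHOLE typed crux — not to "the crux
  off the superspecial-sixfold secant anchors". The line's `_of` theorem is (vacuous) + (junk-false / intended-true) + (crux).
  Recommendation (for the lead / tenure planner, not a stub kill): make the scope GEOMETRIC (`X_k` superspecial abelian sixfold,
  `r = 3`, `𝒳_K` in a Markman secant Weil family, `α ∈ bo(KΞ³ ⊕ HW) + Lef`) or split P2a by anchor class (all three triagers).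
  The other two lines: `cross-ideal-orbit-transport` is honestly typed on real carriers, but its chain STUB1→2→3→4 is `∃ → ∃` at
  each step with unrelated witnesses, so stubs 1–3 pass no information and STUB 4 `ZeroOneAvoidance` (conclusion
  `SemiregularCrossSeeds D`) IS the crux at product-diagonal `E⁴`-anchors (its antecedent `LocallyFreeCrossSeeds` is classically
  cheap: `Φ_𝒫(𝓘_Z ⊗ Θ^t)` for a suitable 2-cycle `Z`); `gorenstein-ci-seeds` has a geometric scope (`InFermatScope`: `r = 2`,
  Fermat fourfold anchors, saturated target span) and an honest residual (= the crux elsewhere), its supply stub `EigenCISupply`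
  is a genuine open ∃-statement not cheaply attackable (infinite search over CI data over `𝔽̄_p`); §H2 below bears on its
  UNSATURATED complement and on the shape of any Fermat seed.
* §H2 (section `CycleThree_FermatSextic`; kit job `j010476` = `comp/{sextic_rho, sextic_containment, sextic_obstruction}.py`,
  exact arithmetic, CONTROL-validated) — NEW ANCHOR CLASS WHERE THE CRITERION IS EXACT AND A STRUCTURAL OBSTRUCTION APPEARS:
  the FERMAT SEXTIC FOURFOLD `X = {Σ xᵢ⁶ = 0} ⊂ ℙ⁵`, `p ≡ 5 (mod 6)`, `p ≥ 11` (`p = 11`: `6 ∣ 12`, Shioda–Katsura supersingular and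
  unirational; smooth hypersurface ⇒ torsion-free Hodge cohomology; `4 + 6 < 11`): an anchor for EVERY `W`-lift `𝒳` of `X_k`.
  It is Calabi–Yau (`ω ≅ 𝒪`, `h^{2,0} = h^{0,2} = 0`, `h^{3,1} = h^{1,3} = 426 = dim H¹(T)`, `h^{2,2} = 1752`), so `HT² = H¹(T)`,
  `HΩ₋₂ = H^{1,3} = H¹(T)^∨` and LEMMA B IS EXACT: `σ = σ₁ = evᵗ` (Serre duality + `Tr((ξ⌟At)∘x) = ⟨Tr(At∘x), ξ⟩`, char-free), so
      `E` p-adically semiregular ⇔ `ev : H¹(T_X) → Ext²(E,E)` onto ⇔ `ext²(E,E) = ρ(P_E) := rank(m_{P_E} : R₆ → R₁₈)`,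
  `R = k[x₀..x₅]/(xᵢ⁵)` the Jacobian ring, `P_E ∈ R₁₂ ≅ H^{2,2}_prim` the Hodge class of `ch₂(E)` (`sextic_numbers`). NEW FACTS:
  (a) CENSUS `m = 6`: units of `ℤ/6` are `±1`, so EVERY one of the `1751` `(2,2)`-characters is totally Hodge — ALL of
  `H^{2,2}(X⁴₆)` (dim `1752`) consists of Hodge classes at the Fermat lift (all algebraic in char 0: Shioda, `m ≤ 20`); split
  `1751 = 1001` three-pair `+ 720` saturated non-pair `+ 30` UNSATURATED (the pair type `a = (1,1,4,4,4,4) ↔ −a = (5,5,2,2,2,2)`,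
  `15` pairs, `2a` of type `(3,1)`) = exactly the line card's "m = 6: 3 sat / 1 unsat" orbits (`sextic_census`). (b) ρ-TABLE (the
  `ext²` a seed with that Hodge class must have EXACTLY): plane bundle `19 = h¹(N)` (control, = CRUX-ATTACK §E); pure rational pair
  classes `u = x^b + c·x^{4−b}`: unsaturated `112 (= 68 + 44)`, saturated non-pair `90 / 150 / 148`, three-pair `38 … 182`,
  self-dual `(3,3,3,3,3,3)`: `141`; identical mod `11` and mod `10⁶+3`. (c) FIRST-ORDER HODGE LOCI: along the Zariski tangent
  space `T(u) = ker m_{P_u}` of the Hodge locus of a pure pair class `u`, the ONLY rational pair class staying Hodge is `u`'s own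
  (all 14 types; for the 6 types with `ρ(u) = ρ(x^b) + ρ(x^{b'})`, e.g. the unsaturated one, the whole 2-plane `U_π = ⟨x^b, x^{b'}⟩`
  stays Hodge). (d) **SECOND-ORDER OBSTRUCTION (the structural result).** By Griffiths–Dwork reduction at the Fermat point
  (`[x^ν Ω/F^{q+1}] = ((νᵢ−5)/(6q))·[x^{ν−6eᵢ} Ω/F^q]`, character-pure) the second-order obstruction to smoothness of the Hodge
  locus `H_v` of a class `v` with Hodge polynomial `P_v` is the symmetric trilinear form `τ_v(ρ,ξ,η) = C₃(ρξη)` on `T(v)` (honest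
  polynomial products; ONE carry lands in `H^{2,2}`: `C₃(ν) = ((νᵢ−5)/18)·c_v(ν − 6eᵢ)` when exactly one `νᵢ ∈ [5,10]`), plus the
  forms `C₃(Aξη)` for the 36 non-reduced `A`. RESULT: `τ ≡ 0` for the PLANE class `[P]_prim` (125 characters with the
  Movasati–Villaflor phases `ζ₁₂^{β₁+β₃+β₅}`; CONTROL = their theorem that `H_[P]` is smooth reduced, arXiv:1705.00084 Thm 2 incl.
  `(n,d) = (4,6)`) — and `τ ≢ 0` (OBSTRUCTED) for the pure pair classes of 12 of the 14 types (all `c ∈ {1,2,3}`, both test primes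
  `1009, 37`), INCLUDING the unsaturated type and all three saturated non-pair types, and for every single character; unobstructed
  to second order only for the balanced types `(2,2,3,3,4,4)` and `(3,3,3,3,3,3)`. For the unsaturated type `T(u)` is the MONOMIAL
  space `{x^γ : γ ∤ x^b, γ ∤ x^{b'}}` (independent of `c`) and the witness is by hand:
  `(6,0,3,3,3,3) = (2,0,2,2,0,0)+(2,0,1,1,2,0)+(2,0,0,0,1,3)` (`sextic_obstruction_witness`, `decide`).
  (e) CONSEQUENCE — REFUTED STRENGTHENING "PURE SEEDS". A semiregular `E` forces `H_{ch₂(E)}` SMOOTH at the Fermat point, in every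
  characteristic where the Jacobian calculus holds (`p ≥ 11`), by an argument that uses NO `σ(ob) = ob(ch)` compatibility (no P1b):
  `σ₁` injective ⇔ `ev` onto (Lemma B) ⇒ `Def(X_k, E)` is SMOOTH (lift `X` first — hypersurface — then kill the obstruction
  `o ∈ Ext² ⊗ I` of `E` by re-choosing the ambient lift, `o ↦ o + ev(ξ)`); its image `S_E ⊆ H_{ch₂ E}` has
  `dim S_E ≥ dim Def(X,E) − ext¹(E,E) = 426 − ρ = dim T(ch₂ E) = embdim H_{ch₂E}` (dimension inequality for the local map of hulls;
  Griffiths transversality / Katz–Oda for the tangent space), and a germ of embedding dimension `d` containing a `d`-dimensional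
  germ is smooth and equal to it. HENCE: **no semiregular sheaf or perfect complex on the Fermat sextic fourfold (over `ℂ`, or over
  `𝔽̄_p`, `p ≥ 11`) has `ch₂ ≡ λ·u (mod h²)` for a pure pair class `u` of an obstructed type** — in particular none for the 30
  unsaturated and the 720 saturated non-pair rational Hodge classes taken individually: every seed reaching them carries further
  character pairs whose presence smooths the locus (as the 125-character plane class does). This does NOT kill the crux (only the
  SPAN is required; the `μ₆⁶`-orbit of one broad seed spans every pair in its support), but it is the first constraint on seeds that
  no count (`χ`, `ρ₂`, parity) sees, and it gives: (f) CONDITIONAL KILL. If the `p`-adic Hodge locus `H_{U_π} ⊂ Def_W(X_k)`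
  (`≅ (pW)^{426}`) of the rational 2-plane `U_π` of an obstructed pair type has a positive-dimensional component `Y⁰` through the
  Fermat point along which no rational class outside `ℚh² ⊕ U_π` stays Hodge (its FIRST-ORDER version is (c); the locus is now known
  SINGULAR at `0`, so this is a statement about its tangent cone / global structure — computable to any finite order by the
  Movasati–Villaflor "Hodge locus ideal" algorithm, cf. arXiv:2112.14818, 2001.01019), then P2a is FALSE at the anchor `(p, 𝒳_y)`,
  `y ∈ Y⁰(W)` very general (Baire on `(pW)^{426}`): there the Hodge condition confines `ch₂` of every seed to `ℚh² ⊕ U_π` with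
  VISIBLE `U_π`-part (an invisible one forces `P_E = 0`, `Ext²(E,E) = 0`, `E` lifts everywhere, `ch₂(E) ∈ ℚh²` by big monodromy of
  sextic fourfolds), i.e. to a pure pair class — which (e) forbids. (g) BY-PRODUCT FOR THE PROVERS: at CY-fourfold anchors with
  `h^{2,0} = 0` the PAIR `(X_k, E)` of a semiregular `E` is unobstructed over `W` for free; P1 for a FIXED lift reduces to the
  independence of the obstruction from the choice of `E_A` over `X_A` = `σ₁(o) = ob_GM(ch₂)` to first order in the ideal (P1b,
  `q = 1`, Bloch 1972's case) — the sextic anchor isolates exactly that. (h) Literature this cycle (zbMATH answered; searchd rc 75,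
  arXiv/S2 429): Movasati–Villaflor arXiv:1705.00084 READ pp. 3, 8, 9 (Thm 1 periods of linear cycles with phases
  `ζ_{2d}^{Σ i_{b_{2e+1}}(1+2a_{2e+1})}`; Thm 2: `V_{[Z]}` smooth reduced incl. `(4,6,−1),(4,6,0)`; "for larger m it fails",
  [WhyShouldOne] = arXiv:1602.06607); Duque Franco–Villaflor arXiv:2112.14818 (fake linear cycles, ANT 2023) and Villaflor
  arXiv:2001.01019 (small-codimension components of the Hodge locus through Fermat) — the printed home of (d)-type computations; no
  printed statement about pure character classes or about semiregular sheaves on Fermat varieties in characteristic `p` was found.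
* §H3 (doc only) — PRODUCT-K3 ANCHORS `S_k × S'_k` (supersingular K3s, `p ≥ 11`; lifts are products `𝒮 × 𝒮'`): `τ = 2 + 40 + 2
  = 44 = dim HT²`; Hodge-origin classes in `H² ⊗ H²` at a lift = Hodge morphisms `T(𝒮_K) → T(𝒮'_K)`; ISOMETRIES are reached by
  Fourier–Mukai kernels (universal sheaves `𝓔` on `S × M_S(v)`, `Ext²(𝓔,𝓔) = HH²(S)`, `ext² = 22`, `ev` onto, `ω ≅ 𝒪` ⇒ semiregular,
  locally free for `r ≥ 2`), budget for a similitude-type class `44 − 20 = 24 ≥ 22`: no forced kernel; the open content (Hodge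
  SIMILITUDES of K3 type) is literally the NikulinTwinTransport routes' item `HodgeSimilitudeAlgebraic` — a cross-route identity, not
  a weakness of this crux.
* §H4 WHY IT STILL RESISTS, AND THE NEXT COMPUTATION. A kill needs CONFINEMENT of `ch₂` (very general anchor in a small Hodge locus)
  AND an obstruction for the confined classes; (e) supplies the second half at the sextic for pure pair classes; the first half is
  the global geometry of a singular Hodge locus (f). Next: (1) order-3/4 structure of `H_{U_π}` for the unsaturated pair at the
  Fermat sextic (MV algorithm; if the reduced tangent cone at `0` still excludes all other rational classes, (f) fires and the crux
  falls at `p = 11`); (2) the same (d)–(e) calculus at the Fermat QUARTIC fourfold is NOT available as is (`ω = 𝒪(−2)`, Lemma B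
  not exact: `σ₁ = evᵗ` needs `H¹(T ⊗ ω)`), nor at cubic fourfolds (`τ = 1`, §C); (3) `ℚ(i)`-Weil `E⁴` anchors (§G4) remain
  without a construction; (4) lead's stubs once a line is picked.

## Cycle 4 findings (refuter-cdisprove-…-13941-g4-0, 2026-08-16; section `CycleFour_Review`, namespace `Repair`; CHECKED)

**▶ KILL RE-VERIFIED AND CERTIFIED; CLASSIFICATION REVISED.** (§H6) (1) An independent seat re-derived `KILL.md` line by line
(`KILL-REVIEW.md`, item evidence): the refutation of P2a AS FILED stands; clarifications R1–R3 (subset of relations; `𝒵 := e_π𝒵`;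
the cycle exists by Shioda's inductive structure from a divisor on `X¹₆ × X¹₆` — the graph of a CM isogeny — without HC(`X⁴₆`)).
(2) The finite certificate is COMPLETE and kernel-checked in the Negative file `Negative/SexticSliceCertificate.lean` (proposed
`--supports`; `|Λ₁| = 162`, census 18/1/1/0, completeness of `D`, confinement 48 → `{b,c,c′,b′}`, equation direction, witnesses and
their counts) together with a SECOND INDEPENDENT SLICE `Λ₂` (census 22/2/2/0, `|D₂| = 25`, confinement 59 → `{b,b′}`: cases 2, 4 only).
(3) The minimal repair `C′ = Repair.SemiregularSeedsOnRestrictedAnchors` (anchor := abelian scheme over `W` ∨ Fermat lift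
`X^n_m ⊗ W`, `m ∣ p^ν + 1` — exactly the two classes the Assembly consumes) is typed, is weaker than the crux
(`semiregularSeedsOnRestrictedAnchors_of`), splits as (A) ∧ (F) (`…_iff`), and is NOT bitten by the witness (no confinement at
the Fermat lift; special subvarieties smooth and `HT² ≠ H¹(T)` at abelian anchors, `abelianFourfold_commutative_deficit`).
Repair-mode token: refuted-MISSTATED (over-broad anchor class; `C′` written and missed) — with the riders that `C′` is OPEN (the
crux's real content) and that the general-anchor mechanism ("supersingular points on Hodge loci", `HodgeBeyondAnchors`) is
substantively dead. Recommended restatement: split P2a into `SemiregularSeedsOnAbelianAnchors` / `SemiregularSeedsOnFermatLifts`.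
(4) New inside `C′`-(F): the FULL second-order test (kernel basis + trilinear form; control = plane class unobstructed, reproduced
independently) finds every tested `(linear-cycle classes) + λu` OBSTRUCTED at the Fermat sextic point (`fermatLift_secondOrder_dims`):
generically no semiregular object has `ch₂ ≡ planes + λu (mod h²)`, `λ ≠ 0` — decorating plane bundles cannot reach the unsaturated pair.

## Conventions

`k = 𝔽̄_p`, `W = W(k)`, `K = W[1/p]`; `X_k` special fibre, `X_K` generic fibre of the anchor `𝒳/W`;
`T^r = (H^{2r}_cris ⊗ K)^{φ = p^r}` (a `ℚ_p`-space), `F^•` the Hodge filtration of `X_K`;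
`V_𝒳 := T^r ∩ F^r = H^{2r}_ét(X_K̄, ℚ_p(r))^{G_K}` (Fontaine) — the p-adic Tate classes of the lift;
`N^r(X_k)` algebraic classes; `Φ_ℚ = ⟨1, θ, θ², w₊, w₋, θ³, pt⟩_ℚ` the forced family at a very general
Weil lift (every seed has `ch E ∈ Φ_ℚ`: `V_𝒳 ∩ N_ℚ = Φ_ℚ` by Baire on `D_W(W) ≅ (pW)⁴` — each rational
`u ∉ Φ_ℚ` is Hodge only on a proper closed analytic `Z_u`, proper because the universally-Hodge classes
over the Weil disc are the `U(V_i)`-invariants `Φ`, and the p-adic period map is étale).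
-/

set_option linter.dupNamespace false

noncomputable section

namespace Summit.HodgeConjecture.HodgeConjecture.Cruxes.SemiregularSeedsOnAnchors.Disproof

open Literature.AlgebraicGeometry.HodgeTheory

universe u v

section Redecoration

variable {𝕜 : Type u} [CommRing 𝕜]

/-- Re-decoration 1: kill the trace. -/
def killTrace (A : AtiyahTraceAlgebra.{u, v} 𝕜) : AtiyahTraceAlgebra.{u, v} 𝕜 :=
  { A with trace := fun _ _ => 0 }

theorem semiregularityComponent_killTrace (A : AtiyahTraceAlgebra.{u, v} 𝕜) (k : ℕ) :
    (killTrace A).semiregularityComponent k = 0 := by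
  ext x
  have htr : (killTrace A).trace (k + 2) k = 0 := rfl
  rw [AtiyahTraceAlgebra.semiregularityComponent_apply, htr]
  simp

theorem not_isSemiregular_killTrace (A : AtiyahTraceAlgebra.{u, v} 𝕜) [Nontrivial (A.Ext 2 0)] :
    ¬ (killTrace A).IsSemiregular := by
  intro h
  rw [AtiyahTraceAlgebra.isSemiregular_iff] at h
  obtain ⟨x, hx⟩ := exists_ne (0 : A.Ext 2 0)
  exact hx (h x fun k => by rw [semiregularityComponent_killTrace]; rfl)

/-- Re-decoration 2: the tautological algebra on a commutative algebra `S`. -/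
def tautological (S : Type v) [CommRing S] [Algebra 𝕜 S] : AtiyahTraceAlgebra.{u, v} 𝕜 where
  Ext := fun _ _ => S
  Coh := fun _ _ => S
  one := 1
  mul := fun _ _ => LinearMap.mul 𝕜 S
  one_mul := fun x => one_mul x
  mul_one := fun x => mul_one x
  mul_assoc := fun _ _ _ _ _ _ _ _ x y z => mul_assoc x y z
  trace := fun _ _ => LinearMap.id
  atiyah := (1 : S)

theorem isSemiregular_tautological (S : Type v) [CommRing S] [Algebra 𝕜 S] :
    (tautological (𝕜 := 𝕜) S).IsSemiregular := by
  rw [AtiyahTraceAlgebra.isSemiregular_iff]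
  intro x hx
  have h0 := hx 0
  rw [AtiyahTraceAlgebra.semiregularityComponent_zero_apply] at h0
  exact h0

end Redecoration

section ForcedKernel

variable {K : Type u} [Field K] (A : AtiyahTraceAlgebra.{u, v} K)

/-- A sheaf with `Ext² = 0` is semiregular for free. -/
theorem isSemiregular_of_subsingleton [Subsingleton (A.Ext 2 0)] : A.IsSemiregular :=
  fun x y _ => Subsingleton.elim x y

/-- The components of `σ` supported on a finite set `S` of form degrees, bundled as one linear map
into the finite product. -/
def sigmaOn (S : Finset ℕ) : A.Ext 2 0 →ₗ[K] ((k : S) → A.Coh (k + 2) k) :=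
  LinearMap.pi fun k => A.semiregularityComponent k

@[simp]
theorem sigmaOn_apply (S : Finset ℕ) (x : A.Ext 2 0) (k : S) :
    sigmaOn A S x k = A.semiregularityComponent k x :=
  rfl

/-- If every component `σ_k`, `k ∉ S`, vanishes identically (e.g. because its target
`H^{k+2}(X, Ω^k)` is zero), semiregularity is injectivity of the finitely many components `σ_S`. -/
theorem isSemiregular_iff_injective_sigmaOn (S : Finset ℕ)
    (hS : ∀ k ∉ S, A.semiregularityComponent k = 0) :
    A.IsSemiregular ↔ Function.Injective (sigmaOn A S) := by
  rw [AtiyahTraceAlgebra.isSemiregular_iff, injective_iff_map_eq_zero]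
  refine forall_congr' fun x => ⟨fun h hx => h fun k => ?_, fun h hx => h ?_⟩
  · by_cases hk : k ∈ S
    · exact congrFun hx ⟨k, hk⟩
    · rw [hS k hk]; rfl
  · funext k
    exact hx k

/-- **Forced kernel.** If the components outside `S` vanish and the targets `H^{k+2}(X, Ω^k)`,
`k ∈ S`, are finite-dimensional, a semiregular sheaf has
`dim Ext²(E,E) ≤ Σ_{k ∈ S} h^{k,k+2}(X)`; contrapositively `dim Ext²(E,E) > Σ_q h^{q,q+2}` FORCES a
kernel of `σ`. This is the numerical principle behind every "forced kernel" attack on the crux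
(`why_might_fail` of the item; CRUX-ATTACK-g2 §4). -/
theorem finrank_ext_le_of_isSemiregular (S : Finset ℕ)
    (hS : ∀ k ∉ S, A.semiregularityComponent k = 0)
    [∀ k : S, FiniteDimensional K (A.Coh (k + 2) k)] (h : A.IsSemiregular) :
    Module.finrank K (A.Ext 2 0) ≤ ∑ k ∈ S, Module.finrank K (A.Coh (k + 2) k) := by
  have hinj := (isSemiregular_iff_injective_sigmaOn A S hS).1 h
  calc Module.finrank K (A.Ext 2 0)
      ≤ Module.finrank K ((k : S) → A.Coh (k + 2) k) :=
        LinearMap.finrank_le_finrank_of_injective hinj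
    _ = ∑ k : S, Module.finrank K (A.Coh (k + 2) k) := Module.finrank_pi_fintype K
    _ = ∑ k ∈ S, Module.finrank K (A.Coh (k + 2) k) :=
        Finset.sum_coe_sort S (fun k => Module.finrank K (A.Coh (k + 2) k))

/-- Contrapositive form: too many obstructions, too few Hodge targets ⇒ not semiregular. -/
theorem not_isSemiregular_of_lt_finrank_ext (S : Finset ℕ)
    (hS : ∀ k ∉ S, A.semiregularityComponent k = 0)
    [∀ k : S, FiniteDimensional K (A.Coh (k + 2) k)] [FiniteDimensional K (A.Ext 2 0)]
    (hlt : ∑ k ∈ S, Module.finrank K (A.Coh (k + 2) k) < Module.finrank K (A.Ext 2 0)) :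
    ¬ A.IsSemiregular :=
  fun h => (Nat.lt_irrefl _) (lt_of_le_of_lt (finrank_ext_le_of_isSemiregular A S hS h) hlt)

end ForcedKernel

section CubicFourfold

/-! ### (b) Tightest honest anchor: the cubic fourfold (`τ = 1`)

For a smooth cubic fourfold `X` (any characteristic `p ∤ 3`, `p ≥ 11` at an anchor) the Hodge
numbers are those of characteristic `0` (Deligne, SGA 7): `h^{0,2} = h^{2,4} = 0`, `h^{1,3} = 1`,
so the target `⊕_q H^{q+2}(X, Ω^q)` of `σ` is ONE-dimensional (`H³(X, Ω¹)`), and only `σ_1`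
is non-zero. Consequences recorded below as theorems over the tree's carrier
`AtiyahTraceAlgebra`: a p-adically semiregular sheaf on a cubic-fourfold anchor has
`ext²(E,E) ≤ 1`, and if `ext² = 1` semiregularity is exactly `σ_1 ≠ 0`. (Supersingular cubic
fourfolds — e.g. Fermat with `p ≡ 2 (mod 3)` — ARE anchors: smooth complete intersection ⇒ (ii),
Shioda–Katsura/Tate ⇒ (i); content lives in `r = 2`, `b_4 = 23`, `Lef² = K h²`.) -/

variable {K : Type u} [Field K] (A : AtiyahTraceAlgebra.{u, v} K)

/-- **Cubic-fourfold forced kernel.** If only `σ_1` can be non-zero (`H²(𝒪) = H⁴(Ω²) = 0`,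
`H^{k+2}(Ω^k) = 0` for `k ≥ 3` on a fourfold) and `h^{1,3} = dim H³(X, Ω¹) = 1`, then a semiregular
sheaf has `dim Ext²(E, E) ≤ 1`. So on a cubic-fourfold anchor every seed is either `Ext²`-rigid
(`ext² = 0`, hence — lifting to EVERY lift and Grothendieck existence — `ch₂ ∈ ℚ h²`, useless) or has
`ext²(E,E) = 1` exactly. -/
theorem cubicFourfold_finrank_ext_le_one (hvan : ∀ k ≠ 1, A.semiregularityComponent k = 0)
    [FiniteDimensional K (A.Coh 3 1)] (h31 : Module.finrank K (A.Coh 3 1) = 1)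
    (h : A.IsSemiregular) : Module.finrank K (A.Ext 2 0) ≤ 1 := by
  have hS : ∀ k ∉ ({1} : Finset ℕ), A.semiregularityComponent k = 0 := fun k hk =>
    hvan k (by simpa using hk)
  haveI : ∀ k : ({1} : Finset ℕ), FiniteDimensional K (A.Coh (k + 2) k) := fun k => by
    obtain ⟨k, hk⟩ := k
    simp only [Finset.mem_singleton] at hk
    subst hk
    exact ‹FiniteDimensional K (A.Coh 3 1)›
  have hle := finrank_ext_le_of_isSemiregular A {1} hS h
  simpa [h31] using hle

/-- **Cubic-fourfold semiregularity criterion.** With the same vanishing and `ext²(E,E) = 1`,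
`E` is semiregular iff `σ_1 = tr(− ∘ At(E)) : Ext²(E,E) → H³(X, Ω¹)` is non-zero. By
Buchweitz–Flenner Prop. 4.2 (`σ_1(⟨η, At E⟩) = ⟨η, ch₂(E)⟩`) this holds as soon as the Hodge
class `ch₂^{Hdg}(E) ∈ H²(X_k, Ω²)` is not in `k·h²` (the IVHS pairing
`H¹(T) ⊗ H^{3,1} → H^{2,2}_prim` of a cubic fourfold is an isomorphism `R₃ ⊗ R₀ → R₃` of
Jacobian-ring pieces, in every characteristic `p ≥ 5`): this is how `E_P` (plane bundles,
CRUX-ATTACK §E) and every SIMPLE object of the Kuznetsov component `𝒜_X` (`ext² = hom = 1` by the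
Serre functor `S_𝒜 = [2]`, characteristic-free) become seeds; see the `NearMisses` discussion. -/
theorem cubicFourfold_isSemiregular_iff (hvan : ∀ k ≠ 1, A.semiregularityComponent k = 0)
    [FiniteDimensional K (A.Ext 2 0)] (h1 : Module.finrank K (A.Ext 2 0) = 1) :
    A.IsSemiregular ↔ A.semiregularityComponent 1 ≠ 0 := by
  constructor
  · intro h hzero
    rw [AtiyahTraceAlgebra.isSemiregular_iff] at h
    have hpos : 0 < Module.finrank K (A.Ext 2 0) := by omega
    obtain ⟨x, hx⟩ := Module.finrank_pos_iff_exists_ne_zero.1 hpos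
    refine hx (h x fun k => ?_)
    by_cases hk : k = 1
    · subst hk
      rw [hzero]
      rfl
    · rw [hvan k hk]
      rfl
  · intro hne
    rw [AtiyahTraceAlgebra.isSemiregular_iff]
    intro x hx
    by_contra hx0
    apply hne
    ext y
    obtain ⟨c, rfl⟩ := (finrank_eq_one_iff_of_nonzero' x hx0).1 h1 y
    rw [map_smul, hx 1, smul_zero]
    rfl

/-- Griffiths' residue count for a smooth cubic `n`-fold (`p ∤ 3`, `p > n + 1`): the primitive Hodge
number `h^{n-q,q}_prim` is the number of square-free monomials of degree `3(q+1) - (n+2)` in `n + 2`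
variables (the Jacobian ring of `Σ xᵢ³` is `k[x]/(xᵢ²)`), i.e. `C(n+2, 3q+1-n)` (zero when
`3q + 1 < n`). [folklore: Griffiths 1969; Katz–Deligne SGA 7 for char `p`] -/
def cubicHodgePrim (n q : ℕ) : ℕ :=
  if n ≤ 3 * q + 1 then Nat.choose (n + 2) (3 * q + 1 - n) else 0

/-- Cubic fourfold: `(h^{4,0}, h^{3,1}, h^{2,2}_prim, h^{1,3}, h^{0,4}) = (0, 1, 20, 1, 0)`; hence the
semiregularity target `τ = h^{0,2} + h^{1,3} + h^{2,4} = 0 + 1 + 0 = 1` used above, and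
`dim H¹(T_X) = h^{2,2}_prim = 20`. -/
theorem cubicFourfold_hodgeNumbers :
    (cubicHodgePrim 4 0, cubicHodgePrim 4 1, cubicHodgePrim 4 2, cubicHodgePrim 4 3,
      cubicHodgePrim 4 4) = (0, 1, 20, 1, 0) := by
  decide

/-- Cubic sixfold (`n = 6`, `r = 3`): `h^{4,2} = 8`, `h^{3,3}_prim = 70`; target `τ = h^{2,4} = 8`.
Cubic eightfold: `h^{5,3} = 45`; tenfold: `h^{7,3} = 1`, `h^{6,4} = 220`. The cubic fourfold is the
only cubic with a ONE-dimensional target. -/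
theorem cubicHigher_hodgeNumbers :
    (cubicHodgePrim 6 2, cubicHodgePrim 6 3, cubicHodgePrim 8 3, cubicHodgePrim 10 3,
      cubicHodgePrim 10 4) = (8, 70, 45, 1, 220) := by
  decide

/-- Abelian fourfold (the route's first test, CRUX-ATTACK-g2 §4): `h^{a,b} = C(4,a)·C(4,b)`, so the
target has dimension `τ = h^{0,2} + h^{1,3} + h^{2,4} = 6 + 16 + 6 = 28`, against which g2 computed
the contraction rank `ρ₂ ≤ 24` on the forced family. -/
theorem abelianFourfold_target :
    Nat.choose 4 0 * Nat.choose 4 2 + Nat.choose 4 1 * Nat.choose 4 3 +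
      Nat.choose 4 2 * Nat.choose 4 4 = 28 := by
  decide

/-! #### §C-doc: paper consequences at cubic-fourfold anchors (not formalisable on today's carriers)

1. **`Ext²(E,E) = 0 ⇒ ch₂(E) ∈ ℚh²`.** An `Ext²`-rigid `E` lifts to every formal lift of `X_k`
   (unobstructed), algebraises (Grothendieck existence, `𝒳` projective), so `ch₂(E)` is algebraic on
   EVERY lift `X_K`. For each rational `u ∈ N²(X_k)_ℚ ∖ ℚh²` the lifts on which `u` is Hodge form a closed
   analytic `Z_u(W) ⊊ (pW)^{20}` (proper: the p-adic period map of cubic fourfolds on the unramified disc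
   is étale — Griffiths transversality/IVHS `R₃ ⊗ R₀ ≅ R₃` — so its image is open, and a class orthogonal
   to an open piece of the period quadric is orthogonal to all of `h²^⊥`, i.e. lies in `ℚh²`). Baire on the
   complete space `(pW)^{20}` gives a lift outside `⋃_u Z_u(W)`, on which the only algebraic classes are
   `ℚh²`; so `ch₂(E) ∈ ℚh²`. Hence useful seeds have `ext²(E,E) = 1` exactly.
2. **Seeds from the Kuznetsov component.** `D^b(X_k) = ⟨𝒜, 𝒪, 𝒪(1), 𝒪(2)⟩`, `S_𝒜 = [2]`
   (Kuznetsov; characteristic-free for smooth cubic fourfolds), so every simple `F ∈ 𝒜_{X_k}` has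
   `ext²_X(F,F) = hom(F,F) = 1`; by BF Prop. 4.2, `σ₁(ev(η)) = η ⌟ ch₂^{Hdg}(F)`, and
   `η ↦ η ⌟ v : H¹(T_X) → H³(Ω¹)` vanishes iff `v ∈ k·h²` (perfect pairing `R₃ × R₃ → R₆ ≅ k`), so
   `ch₂^{Hdg}(F) ∉ k h² ⇒ F` semiregular. Twisted Ulrich bundles (`U(−1) ∈ 𝒜`; rank-2 Ulrich exist iff
   Pfaffian, `d = 14`; rank 6 on every cubic fourfold, Faenzi–Kim) and `E_P` (planes, `d = 8`, g0 §E) are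
   LOCALLY FREE instances; in general stable objects of `𝒜_{X_k}` with Mukai vector of square `≥ −2` are
   complexes. For `X_k ⊃` two disjoint planes (Fermat!) `𝒜_{X_k} ≃ D^b(S_k)`, `S_k` a supersingular K3, and
   `K_num(𝒜_{X_k})` has rank 24: `ch₂` of simple objects of `𝒜` span all of `N²(X_k)_ℚ` mod `h²`.
3. **Hodge origin = algebraic on `X_K`** at these anchors: HC holds for cubic fourfolds (Zucker), classes
   descend from `X_K ⊗_ι ℂ` to `ℚ`-cycles on `X_K` (spread + specialise + Galois average), and a rational
   `u ∈ N²(X_k)_ℚ` with `u ∈ F²(X_K)` is algebraic on `X_K` (transport to `H²` of the Fano variety of lines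
   `F(𝒳)/W` by the incidence correspondence, Berthelot–Ogus 3.8 there, transport back). So the crux at a
   cubic-fourfold anchor reads: for every lift `𝒳`, the algebraic classes `A_𝒳` of `X_K` are spanned mod
   `h²` by `ch₂` of semiregular (`ext² = 1`, `σ₁ ≠ 0`) locally free `E` on `X_k` with `ch₂(E) ∈ A_𝒳`.
4. **"Invisible" lifts — a new necessary condition, not a contradiction.** If `A_𝒳 = ℚh² ⊕ ℚu` with
   `u^{Hdg} ∈ k h²` (the mod-`p` Hodge class of `u` dies modulo `h²`; such `u` exist in `N² ⊗ k` since
   `N² ⊗ k → H⁴_dR/F³` is `23 → 22`, and `h² ∉ F³`; whether a RATIONAL liftable one exists is an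
   Artin-invariant question à la Ogus — for the Fermat lift's own classes, `span(planes) ⊗ k` meets
   `F³ + kh²` only in `kh²` because the plane lattice has discriminant `3`, a unit), then every seed has
   `ch₂^{Hdg}(E) ∈ kh²`, so `σ₁ ∘ ev = 0` on `H¹(T_{X_k})`; semiregularity then forces `ev ≡ 0` (E is
   first-order unobstructed in all 20 directions) together with `ext² = 1`, `σ₁ ≠ 0`; dually
   (`σ₁ᵗ(η₀) = η₀ ∧ At E =: ξ'` spans `Ext²(E, E⊗ω)`) this says `s·ξ' = 0 ∈ Ext²(E,E)` for every cubic
   `s ∈ H⁰(𝒪(3)) = H⁰(ω⁻¹)` (using `H¹(T(−3)) ⊗ H⁰(𝒪(3)) ↠ H¹(T)`, i.e. `R₀ ⊗ S₃ ↠ R₃`), equivalently the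
   Yoneda products `ξ' ∘ s ∘ ξ' ∈ Ext⁴(E, E ⊗ ω) ≅ k` all vanish. Consistent with P1b (such `u` are Hodge
   on EVERY `W₂`-lift, as the linear term of `f_u` vanishes mod `p`, so a semiregular seed must lift to
   every `X₂` — which `ev ≡ 0`-type unobstructedness allows). No contradiction found. -/

end CubicFourfold

section TransposeCriterion

/-! ### (a′) The criterion behind every rank computation: `σ = evᵗ`

On an anchor with trivial canonical bundle (abelian fourfolds) Serre duality identifies
`Ext²(E,E) ≅ Ext²(E,E)^∨` and `⊕_q H^{q+2}(Ω^q) ≅ (HT²)^∨`, and under these `σ` is the transpose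
of Toda's/Buchweitz–Flenner's evaluation map `ev : HT²(X) → Ext²(E,E)` (CRUX-ATTACK-g2, Lemma B);
on a cubic fourfold the same holds with `HT²` replaced by `H¹(T_X ⊗ ω_X) = H¹(Ω³_X) = H^{3,1}`
(one-dimensional): `σ_1ᵗ(η₀) = η₀ ∧ At(E) ∈ Ext²(E, E ⊗ ω_X)`. The linear algebra that turns this
into the computable criterion "semiregular ⇔ `dim Ext² = rank(σ ∘ ev)`" is checked here. -/

variable {K : Type u} [Field K] {H V : Type v} [AddCommGroup H] [Module K H] [AddCommGroup V]
  [Module K V]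

/-- If `σ = evᵗ ∘ e` for a duality `e : V ≃ V^∨` then `σ` is injective iff `ev` is surjective. -/
theorem injective_transpose_iff_surjective (ev : H →ₗ[K] V) (e : V ≃ₗ[K] Module.Dual K V) :
    Function.Injective (ev.dualMap ∘ₗ (e : V →ₗ[K] Module.Dual K V)) ↔ Function.Surjective ev := by
  rw [← LinearMap.dualMap_injective_iff]
  constructor
  · intro h x y hxy
    obtain ⟨x', rfl⟩ := e.surjective x
    obtain ⟨y', rfl⟩ := e.surjective y
    exact congrArg e (h (by simpa using hxy))
  · intro h
    exact h.comp e.injective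

/-- **Lemma B, linear-algebra skeleton** (CRUX-ATTACK-g2 §4): with `σ = evᵗ ∘ e`, `E` is
semiregular iff `dim Ext²(E,E) = rank(σ ∘ ev)`; and `σ ∘ ev` is CONTRACTION WITH THE MUKAI
VECTOR (`⟨ξ, -At⟩ ↦ ⟨ξ, ch⟩`, Buchweitz–Flenner Prop. 4.2 / Cor. 4.3), a matrix one can write down
from `ch(E)` alone — which is what makes "forced kernel" a finite computation per anchor and Mukai
vector (`ρ₂(v)` in g2's scripts). -/
theorem injective_transpose_iff_finrank_range [FiniteDimensional K V] (ev : H →ₗ[K] V)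
    (e : V ≃ₗ[K] Module.Dual K V) :
    Function.Injective (ev.dualMap ∘ₗ (e : V →ₗ[K] Module.Dual K V)) ↔
      Module.finrank K (LinearMap.range ((ev.dualMap ∘ₗ (e : V →ₗ[K] Module.Dual K V)) ∘ₗ ev)) =
        Module.finrank K V := by
  rw [injective_transpose_iff_surjective]
  constructor
  · intro hsurj
    have hinj : Function.Injective (ev.dualMap ∘ₗ (e : V →ₗ[K] Module.Dual K V)) :=
      (injective_transpose_iff_surjective ev e).2 hsurj
    rw [LinearMap.range_comp, LinearMap.range_eq_top.2 hsurj, Submodule.map_top]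
    exact LinearMap.finrank_range_of_inj hinj
  · intro heq
    rw [← LinearMap.range_eq_top]
    apply Submodule.eq_top_of_finrank_eq
    apply le_antisymm (Submodule.finrank_le _)
    calc Module.finrank K V
        = Module.finrank K
            (LinearMap.range ((ev.dualMap ∘ₗ (e : V →ₗ[K] Module.Dual K V)) ∘ₗ ev)) := heq.symm
      _ ≤ Module.finrank K (LinearMap.range ev) := by
          rw [LinearMap.range_comp]
          exact Submodule.finrank_map_le _ _

end TransposeCriterion

section WithoutHodgeOrigin

/-! ### (a) Load-bearing hypothesis (b) "Hodge origin": the count that kills the crux without it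

CRUX-ATTACK-g2 §3, made checkable: on every `W(𝔽_{p²})`-lift of an `E⁴`-anchor the space of
φ-Tate-on-the-nose classes in `F²H⁴_dR` has `ℚ_p`-dimension at least
`b₄ − [K₀:ℚ_p]·(h^{1,3}+h^{0,4}) = 70 − 2·17 = 36`, while at a very general such lift the classes
that seeds-plus-Lefschetz can reach span at most `ℚθ² ⊕ W` (`dim 3`). So the crux with (b) deleted
is false; any proof must use (b). The inequality is rank–nullity: -/

variable {K : Type u} [Field K] {V W : Type v} [AddCommGroup V] [Module K V] [AddCommGroup W]
  [Module K W]

/-- Rank–nullity as a lower bound for a kernel: `dim V ≤ dim ker f + dim W`. -/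
theorem finrank_le_finrank_ker_add [FiniteDimensional K V] [FiniteDimensional K W]
    (f : V →ₗ[K] W) :
    Module.finrank K V ≤ Module.finrank K (LinearMap.ker f) + Module.finrank K W := by
  have h := LinearMap.finrank_range_add_finrank_ker f
  have hr : Module.finrank K (LinearMap.range f) ≤ Module.finrank K W := Submodule.finrank_le _
  omega

/-- The numbers: `b₄(E⁴) = C(8,4) = 70`; `h^{1,3} + h^{0,4} = 4·4 + 1·1 = 17` on an abelian fourfold;
`[W(𝔽_{p²})[1/p] : ℚ_p] = 2`; `70 − 2·17 = 36 > 3 = dim(ℚθ² ⊕ W)`. -/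
theorem withoutHodgeOrigin_count :
    Nat.choose 8 4 = 70 ∧ Nat.choose 4 1 * Nat.choose 4 3 + Nat.choose 4 0 * Nat.choose 4 4 = 17 ∧
      70 - 2 * 17 = 36 ∧ 1 + 2 < 36 := by
  decide

end WithoutHodgeOrigin

section WeilAnchor

/-! ### (c) Weil `E⁴`-anchor (kill criterion (b)): natural strengthenings refuted, and why no kill

Setting (g2, re-derived): `X_k ≅ E⁴`, `E` supersingular, `I = diag(i,i,−i,−i) ∈ M₄(𝒪_B)` (`p ≡ 3 (4)`,
so `i ∈ B_{p,∞}`; tangent signature `(2,2)`), `θ` the product polarisation; lifts in the 4-dimensional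
Weil disc `D_W`; at a very general such lift every admissible seed has `ch E ∈ Φ_ℚ`. Write
`H¹ ⊗ ℚ(ι) = V_i ⊕ V_{-i}` (eigenspaces of `I`), bidegree `(a,b)` = `ΛᵃV_i ⊗ ΛᵇV_{-i}`;
`θ ∈ (1,1)`, `W = (4,0) ⊕ (0,4)`, `NS(X_k)_ℚ = NS⁺ ⊕ NS⁻` (`I^* = ±1`; `NS⁺ ⊗ = (1,1)`,
`NS⁻ ⊗ = (2,0) ⊕ (0,2)`, dimensions `16 + 12 = 28`).

**D2. Two-exponential Mukai vectors never reach the Weil plane (proof).** Let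
`v = r₁e^{d₁} + r₂e^{d₂}`, `rᵢ ∈ ℚ^×`, `dᵢ ∈ NS_ℚ`, satisfy the Hodge conditions at a very general Weil
lift: `v₁ = r₁d₁ + r₂d₂ ∈ ℚθ`, `v₂ ∈ ℚθ² ⊕ W`, `v₃ ∈ ℚθ³`. Twisting by `e^{-v₁/(r₁+r₂)}` (which preserves
`Φ_ℚ`, as `θ·W = 0` for bidegree reasons) we may assume `r₁d₁ + r₂d₂ = 0` when `r₁ + r₂ ≠ 0` (if
`r₁ + r₂ = 0` then `v₁ = r₁(d₁ − d₂) ∈ ℚθ` and the same computation runs with `d₂ = d₁ − mθ/r₁`).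
Decompose `dᵢ = νᵢ + λᵢ`, `νᵢ ∈ NS⁺`, `λᵢ ∈ NS⁻`, `λᵢ = λᵢ^{20} + λᵢ^{02}`. RATIONALITY: the operator
`J := ((1+i)·Id_{X})^*/2` is a rational endomorphism of `NS⁻_ℚ` with `J² = −1` whose `±ι`-eigenspaces
are `Λ²V_{±i}`; hence a non-zero RATIONAL `λ ∈ NS⁻_ℚ` has BOTH `λ^{20} ≠ 0` and `λ^{02} ≠ 0`, and the
projection `NS⁻_ℚ → Λ²V_i` is injective. Now `r₂λ₂ = −r₁λ₁`, `r₂ν₂ = −r₁ν₁`. The `(3,1)`-part of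
`v₂ = Σ rᵢdᵢ²/2` is `Σ rᵢλᵢ^{20}νᵢ = r₁λ₁^{20}(ν₁ − ν₂)`; if the Weil part `Σ rᵢ((λᵢ^{20})² + (λᵢ^{02})²)`
is non-zero then `λ₁ ≠ 0`, so `λ₁^{20} ≠ 0`; if moreover `(λ₁^{20})² ≠ 0` the 2-form `λ₁^{20}` on the
4-space `V_i` is non-degenerate and `λ₁^{20} ∧ a = 0 ⇒ a = 0`, so writing `ν₁ − ν₂ = Σ_j a_j ⊗ y_j`
(`y_j` a basis of `V_{-i}`) the `(3,1)`-condition gives `a_j = 0`, i.e. `ν₁ = ν₂`, whence (from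
`r₁ν₁ + r₂ν₂ = 0` and `r₁ + r₂ ≠ 0`) `ν₁ = ν₂ = 0`. [If `(λ₁^{20})² = 0` then by `J`-conjugacy
`(λ₁^{02})² = 0` too and the Weil part vanishes — contradiction.] The `(2,2)`-part of `v₂` is then
`Σ rᵢ λᵢ^{20}λᵢ^{02} = (r₁ + r₁²/r₂) λ₁^{20} ⊗ λ₁^{02}`, a tensor of rank ≤ 1 in `Λ²V_i ⊗ Λ²V_{-i}`, required
to be a rational multiple of the `(2,2)`-component of `θ²`, which is `2Σ_{k<l}(x_k∧x_l)⊗(y_k∧y_l)`, of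
tensor rank 6. Hence `λ₁^{20} ⊗ λ₁^{02} = 0` (note `r₁ + r₁²/r₂ = r₁(r₁+r₂)/r₂ ≠ 0`), so one factor
vanishes, so (`J`-conjugacy) `λ₁ = 0`: the Weil part is zero. ∎ Covers: `L₁ ⊕ L₂` (g2 §5, now proved),
extensions `0 → V₁ → E → V₂ → 0` and kernels/cokernels `V₁ → V₂` of two semi-homogeneous bundles
(`ch Vᵢ = rᵢ e^{δᵢ/rᵢ}`), and `E ⊗`(such). For `s ≥ 3` exponential terms the same equations number
`32 + 35 + 12 + 15 = 94` against `58` (`s = 3`), `87` (`s = 4`), `116` (`s = 5`) unknowns: `s = 3, 4`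
are over-determined (expected empty, unverified), `s ≥ 5` is expected non-empty — and MUST eventually be,
since exponentials of divisors span all algebraic classes of `X_k`. So D2 is NOT a route to a kill; it only
says seeds are not "toric of length ≤ 2".

**D3. Untwisting by `End`.** For a `μ_r`-twisted or untwisted `E` of rank `r ≥ 2`, `End E = 𝒪 ⊕ End₀E`
is untwisted with `ch(End E) = κ(E)κ(E)^∨`, automatically inside the Hodge-staying ring, `c₁ = 0`, and
`ch₂(End E) = 2κ₂(E)` keeps the Weil component. But
`Ext²(End E, End E) ⊇ H²(𝒪) ⊕ Ext²(E,E)₀ ⊕ Ext²(E,E)₀ ⊕ Ext²(End₀E, End₀E)` has dimension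
`≥ 6 + 2(ext²(E,E) − 6) + 6` (Mukai: `H²(𝒪_X)·id ↪ Ext²(F,F)` for every `F ≠ 0`), while a seed needs
`ext² = ρ₂ ≤ 24` (`abelianFourfold_target`, g2): so `End E` can be a seed only if `ext²(E,E) ≤ 12`
(`untwist_by_End_needs_ext2_le_12`). For Markman-type `E` (`ext²(E,E) = 18` in the smallest case, §E)
`End E` is NOT semiregular: forced kernel.

**D4. No untwisting from the supersingular Néron–Severi jump.** See the index: `Br(X_k)[r] = 0`
(`p ∤ r`) but `coker(NS(X_K̄) → NS(X_k))` has no `r`-torsion, so the congruence `c₁ ≡ m h (mod r·NS)`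
needed to turn a twisted `B_k` with trivial determinant into an honest sheaf with `c₁ ∝ h` is the SAME
congruence as in characteristic 0, where it fails for Markman's `B` (else no twist would be needed).

**D5. Visibility of `Φ` on the special fibre.** In the Dieudonné basis (`D(E) = We₁ ⊕ We₂`, `Fe₁ = e₂`,
`Fe₂ = ±pe₁`; `H⁰(Ω¹_E) = kē₂`, `H¹(𝒪_E) = kē₁`; `i` acts on `ē₂` by `ι₀` and on `ē₁` by `−ι₀`):
`V_i mod p = ⟨ē₂¹, ē₂², ē₁³, ē₁⁴⟩`, `ŵ₊ = l₁⁺l₂⁺l₃⁻l₄⁻ ↦ ē₂¹ē₂²ē₁³ē₁⁴ ≠ 0` of Hodge type `(2,2)`,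
`φŵ₊ = p²·unit·ŵ₋`, `φŵ₋ = p²·unit·ŵ₊`, so `T² ∩ (W ⊗ K) = {aŵ₊ + σ(a)u ŵ₋}` and every rational Weil
class has unit coordinates on both `ŵ±`: VISIBLE. Per pair of factors the Tate lattice is
`W·pe₁e₁ ⊕ We₂e₂ ⊕ We₁e₂ ⊕ We₂e₁`, so `ker(NS ⊗ k → H²_dR) = ⟨pe₁ᵃe₁ᵇ⟩` (dim 6), the image is exactly
`F¹H²_dR` (dim 22), and `ker(NS ⊗ k → H¹(Ω¹)) ` has dimension `6 + 6 = 12` (the `e₂ᵃe₂ᵇ` land in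
`H⁰(Ω²)`). Consequence: contraction ranks `ρ₂(v^{Hdg})` computed with SPECIAL-fibre Hodge classes agree
with g2's for `v ∈ Φ_ℚ`, but drop for Mukai vectors involving the invisible divisor classes. -/

/-- D3's count: with `ext²(E,E) = e ≥ 6` on an abelian fourfold, `End E` has
`ext² ≥ 6 + 2(e − 6) + 6`, and this is `≤ 24` iff `e ≤ 12`. -/
theorem untwist_by_End_needs_ext2_le_12 (e : ℕ) (he : 6 ≤ e) :
    6 + 2 * (e - 6) + 6 ≤ 24 ↔ e ≤ 12 := by
  omega

/-- §E's count: for `E = Φ(F₁^∨ ⊠ F₂)` with `Fᵢ` simple on an abelian surface, `ext¹(Fᵢ) = vᵢ² + 2`,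
`ext²(E,E) = 1 + (v₁²+2)(v₂²+2) + 1` (Künneth), and `rank ev ≤ 1 + 4·4 + 1 = 18`; so `ev` can be
surjective only for `v₁² = v₂² = 2`, where `ext² = 18 ≤ 24`. (Here `a = v₁²`, `b = v₂²`, even,
positive for a `K`-secant: the binary form on `P` must be anisotropic over `ℚ`.) -/
theorem secant_fourfold_ext2_count (a b : ℕ) (ha : 2 ≤ a) (hb : 2 ≤ b) :
    1 + (a + 2) * (b + 2) + 1 ≤ 1 + 4 * 4 + 1 ↔ a = 2 ∧ b = 2 := by
  constructor
  · intro h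
    have h1 : (a + 2) * (b + 2) ≤ 16 := by omega
    have ha4 : a + 2 ≤ 4 := by
      by_contra hc
      have : 5 * 4 ≤ (a + 2) * (b + 2) := Nat.mul_le_mul (by omega) (by omega)
      omega
    have hb4 : b + 2 ≤ 4 := by
      by_contra hc
      have : 4 * 5 ≤ (a + 2) * (b + 2) := Nat.mul_le_mul (by omega) (by omega)
      omega
    omega
  · rintro ⟨rfl, rfl⟩
    norm_num

/-- The 2 × 2 identity behind `ρ¹(1, ℓ, 0) = 2 + rank(M R Mᵗ) = 4 ⇔ det M ≠ 0` in §E′: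
`M R Mᵗ = det(M)·R` for the symplectic form `R = [[0,1],[−1,0]]`. -/
theorem symplectic_conj_two (C : Type u) [CommRing C] (M : Matrix (Fin 2) (Fin 2) C) :
    M * !![(0 : C), 1; -1, 0] * M.transpose = M.det • !![(0 : C), 1; -1, 0] := by
  ext i j
  fin_cases i <;> fin_cases j <;>
    simp [Matrix.mul_apply, Fin.sum_univ_two, Matrix.det_fin_two] <;> ring

/-! #### §E′ — the contraction-rank computation behind §E (abelian surface `S`, any characteristic ≠ 2)

`HT¹(S) = H¹(𝒪) ⊕ H⁰(T) = B ⊕ A^∨`, `HΩ₋₁(S) = H¹(𝒪) ⊕ H²(Ω¹) = B ⊕ (A ⊗ Λ²B) ≅ B ⊕ A`, where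
`A = H⁰(Ω¹_S)`, `B = H¹(𝒪_S)` (2-dimensional; on `S_k = E²_ss`: `A = ⟨ē₂¹, ē₂²⟩`, `B = ⟨ē₁¹, ē₁²⟩`).
For `u = r + M + s·pt^{Hdg}` (`M ∈ A ⊗ B` the Hodge class of `c₁`, `pt^{Hdg} = a₁a₂ ⊗ b₁b₂ ≠ 0`):
`ξ ∈ B ↦ (rξ, M ∧ ξ)`, `τ ∈ A^∨ ↦ (τ ⌟ M, s·τ ⌟ (a₁∧a₂))`, i.e. the block matrix `[[r·I₂, Mᵗ],[M R, s J]]`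
with `R, J` the two symplectic identifications. If `r ≠ 0` its Schur complement is `(s ∓ det M / r)·J`,
so `ρ¹(u) = 4 ⇔ rs ≠ ±det M`; for a visible `ℓ`, `det M = ℓ²/2` and (with the sign that makes `𝓘_x`
work) the condition is `v² = ℓ² − 2rs ≠ 0 (mod p)`. Instances: `v(𝓘_x)^∨ = (1, 0, −1)`: matrix
`diag(I₂, −J)`, rank 4; `v(L ⊗ 𝓘_y) = (1, ℓ, 0)`, `ℓ` principal: `[[I, Mᵗ],[MR, 0]]` has rank
`2 + rank(M R Mᵗ) = 2 + 2·[det M ≠ 0] = 4`. Degree 2: `ρ²(u) = rank(HT²(S) → H²(𝒪)) = 1` as soon as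
`r ≠ 0` (`ζ ↦ rζ`); degree 0: `ρ⁰ = 1`. Künneth: contraction with `u₁ ⊠ u₂` on `S × S` is
`⊕_{a+b=2} C^a_{u₁} ⊗ C^b_{u₂}` into the independent pieces `HΩ₋ₐ ⊗ HΩ₋_b`, so
`ρ₂(u₁ ⊠ u₂) = Σ ρᵃ(u₁)ρᵇ(u₂) = 1·1 + 4·4 + 1·1 = 18`; likewise `ev_{F₁^∨ ⊠ F₂} = Σ evᵃ ⊗ evᵇ` has rank
`1 + 4·4 + 1 = 18 = ext²` (`ev¹_{𝓘_x}` and `ev¹_{L⊗𝓘_y}` are bijective: Pic⁰-twists ⊕ translations), so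
`ev` is surjective, `ker ev = ker(⌟ch)` by equality of ranks, and Markman's Lemma 8.3.4 gives
semiregularity of the box product; `Ext²` being self-dual on the abelian fourfold `S × S`, this is also
g2's criterion `ext² = ρ₂`. For the one-sheaf plane (`v² = 4`, `ext¹ = 6`) the same count is
`1 + 36 + 1 = 38 > 28 ≥ τ`: not semiregular (`secant_fourfold_ext2_count` with `a = b = 4`). -/

end WeilAnchor


/-! ## Cycle 2 (2026-08-16) -/

section CycleTwo_Transport

/-! ### §G1 Transport of semiregularity along an intertwiner (derived invariance, carrier form)

A Fourier–Mukai equivalence `Φ : D(X) ⥤ D(Y)` gives `e : Ext²(E,E) ≃ Ext²(ΦE,ΦE)` and isomorphisms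
`g_k` of the Hochschild/Hodge targets intertwining the semiregularity maps (Perry arXiv:2604.00511
Rem. 2.3; HKR for `p > dim`, Antieau–Vezzosi). Over the carrier this is the following one-liner; its
use in this file: (a) Orlov's `Ψ : D(S×S) ⥤ D(S×Ŝ)` (§E, §G4), (b) Mukai's `Φ_𝒫` after an IT₀ twist,
which turns a COHERENT seed into a LOCALLY FREE one on the dual anchor — so at principally polarised
abelian anchors the two variants of the crux are equivalent (index §G1). -/

variable {K : Type u} [Field K] (A B : AtiyahTraceAlgebra.{u, v} K)

/-- **Transport.** If `e : Ext²_A ≃ Ext²_B` and injective `g_k : H^{k+2}(Ω^k)_A → H^{k+2}(Ω^k)_B`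
intertwine the semiregularity maps (`σ^B_k ∘ e = g_k ∘ σ^A_k`), then `A` semiregular ⇒ `B`
semiregular. [folklore; Perry arXiv:2604.00511 Rem. 2.3 for the geometric instance] -/
theorem isSemiregular_transport (e : A.Ext 2 0 ≃ₗ[K] B.Ext 2 0)
    (g : ∀ k, A.Coh (k + 2) k →ₗ[K] B.Coh (k + 2) k) (hg : ∀ k, Function.Injective (g k))
    (hcomm : ∀ k x, B.semiregularityComponent k (e x) = g k (A.semiregularityComponent k x))
    (hA : A.IsSemiregular) : B.IsSemiregular := by
  rw [AtiyahTraceAlgebra.isSemiregular_iff] at hA ⊢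
  intro y hy
  obtain ⟨x, rfl⟩ := e.surjective y
  have hx : x = 0 := hA x fun k => hg k (by rw [← hcomm, hy k, map_zero])
  rw [hx, map_zero]

/-- The symmetric form: along an intertwiner that is an isomorphism on both sides, semiregularity
is INVARIANT (this is the shape in which `ext²` and `rank ev` are derived invariants, Markman
arXiv:2502.03415 p. 48). -/
theorem isSemiregular_iff_of_intertwiner (e : A.Ext 2 0 ≃ₗ[K] B.Ext 2 0)
    (g : ∀ k, A.Coh (k + 2) k ≃ₗ[K] B.Coh (k + 2) k)
    (hcomm : ∀ k x, B.semiregularityComponent k (e x) = g k (A.semiregularityComponent k x)) :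
    A.IsSemiregular ↔ B.IsSemiregular := by
  refine ⟨isSemiregular_transport A B e (fun k => (g k : A.Coh (k + 2) k →ₗ[K] B.Coh (k + 2) k))
    (fun k => (g k).injective) hcomm, ?_⟩
  refine isSemiregular_transport B A e.symm
    (fun k => ((g k).symm : B.Coh (k + 2) k →ₗ[K] A.Coh (k + 2) k)) (fun k => (g k).symm.injective) ?_
  intro k y
  obtain ⟨x, rfl⟩ := e.surjective y
  rw [LinearEquiv.symm_apply_apply]
  apply (g k).injective
  rw [hcomm k x]
  simp

end CycleTwo_Transport

section CycleTwo_TraceRigid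

/-! ### §G2 Trace-rigid objects are semiregular

If `Ext²(E,E)` is a line on which one component `σ_k` is non-zero, `σ` is injective. With `k = 0`
(`σ₀ = Tr`): `Ext²(E,E) = H²(𝒪_X)·id_E` and `p ∤ rk E` suffice. Instances: line bundles and `𝒪_X`;
ℙⁿ-objects on hyper-Kähler `2n`-folds (`𝒪_P`, `P` a Lagrangian plane); O'Grady's rigid modular
bundles with `H^*(End₀) = 0`; simple objects of the Kuznetsov component of a cubic fourfold (§C, where
the converse needed the vanishing of the other components). Every such object is a seed for ITS OWN
`ch₂` — a forced-kernel kill must rule them out at the offending class. -/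

variable {K : Type u} [Field K] (A : AtiyahTraceAlgebra.{u, v} K)

/-- **2-rigid ⇒ semiregular.** `dim Ext²(E,E) = 1` and `σ_k ≠ 0` for some `k` imply semiregularity
(no hypothesis on the other components; compare `cubicFourfold_isSemiregular_iff`). -/
theorem isSemiregular_of_finrank_ext_eq_one [FiniteDimensional K (A.Ext 2 0)]
    (h1 : Module.finrank K (A.Ext 2 0) = 1) (k : ℕ) (hk : A.semiregularityComponent k ≠ 0) :
    A.IsSemiregular := by
  rw [AtiyahTraceAlgebra.isSemiregular_iff]
  intro x hx
  by_contra hx0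
  apply hk
  ext y
  obtain ⟨c, rfl⟩ := (finrank_eq_one_iff_of_nonzero' x hx0).1 h1 y
  rw [map_smul, hx k, smul_zero]
  rfl

/-- **`Ext² = H²(𝒪)·id ⇒ semiregular`**: with `dim Ext²(E,E) = 1`, non-vanishing of the trace
`Tr : Ext²(E,E) → H²(X,𝒪_X)` (e.g. `Tr(η·id_E) = rk(E)·η`, `p ∤ rk E`) suffices. -/
theorem isSemiregular_of_finrank_ext_eq_one_of_trace [FiniteDimensional K (A.Ext 2 0)]
    (h1 : Module.finrank K (A.Ext 2 0) = 1) (htr : A.trace 2 0 ≠ 0) : A.IsSemiregular := by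
  refine isSemiregular_of_finrank_ext_eq_one A h1 0 ?_
  intro h0
  apply htr
  ext x
  rw [← AtiyahTraceAlgebra.semiregularityComponent_zero_apply, h0]

end CycleTwo_TraceRigid

section CycleTwo_HilbertSquare

/-! ### §G3 The K3^{[2]} anchor: target 23, effective budget 3

See the index. The linear algebra: `σ = evᵗ` (Serre duality, `ω ≅ 𝒪`), so for a semiregular `E`
`ext²(E,E) = rank ev`; `ev` kills every first-order deformation of `X` along which `ch(E)` stays
Hodge (Bloch/BF: `σ(ev ξ) = ξ ⌟ ch E`, `σ` injective), i.e. the hyperplane `ann(h) ⊂ H¹(T_X)`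
(`c₂(X)` stays Hodge everywhere); `dim HT²(X) = h^{0,2} + h^{1,1}_T + h^{0}(Λ²T) = 1 + 21 + 1 = 23`. -/

variable {K : Type u} [Field K] {H V : Type v} [AddCommGroup H] [Module K H] [AddCommGroup V]
  [Module K V]

/-- **Budget collapse** (rank–nullity): if `ev : HT²(X) → Ext²(E,E)` kills a `d`-dimensional
subspace of the `n`-dimensional `HT²`, then `rank ev ≤ n − d`; at a very general polarised
K3^{[2]}-anchor `n = 23`, `d = 20`, so a seed has `ext²(E,E) ≤ 3`. -/
theorem finrank_range_le_of_le_finrank_ker [FiniteDimensional K H] (ev : H →ₗ[K] V) {n d : ℕ}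
    (hn : Module.finrank K H = n) (hd : d ≤ Module.finrank K (LinearMap.ker ev)) :
    Module.finrank K (LinearMap.range ev) ≤ n - d := by
  have h := LinearMap.finrank_range_add_finrank_ker ev
  omega

/-- The numbers used in §G3 for `X` of K3^{[2]} type: `τ = h^{0,2}+h^{1,3}+h^{2,4} = 1+21+1 = 23 =
dim HT²`; `b₄ = dim Sym²H² = C(24,2) = 276` (so `H⁴ = Sym²H²` is Lefschetz on the supersingular fibre,
`ρ = 23`); `χ(𝒪_X) = td₄ = (3c₂² − c₄)/720 = (3·828 − 324)/720 = 3` (so a rigid simple bundle has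
`ext² = χ(E,E) − 2`); budget `23 − 20 = 3`; Lagrangian plane: `c₂(X)|_P = 3 + 3 − 9 = −3`,
`ch₄(𝒪_P) = 1 + 3/12 = 5/4 ≠ 0`. [folklore: Göttsche/Ellingsrud–Strømme numbers of K3^{[2]}] -/
theorem hilbSquare_numbers :
    1 + 21 + 1 = 23 ∧ Nat.choose 24 2 = 276 ∧ (3 * 828 - 324) / 720 = 3 ∧ 23 - 20 = 3 ∧
      (3 : ℤ) + 3 - 9 = -3 ∧ (1 : ℚ) + 3 / 12 = 5 / 4 := by
  refine ⟨by decide, by decide, by decide, by decide, by norm_num, by norm_num⟩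

end CycleTwo_HilbertSquare

section CycleTwo_SecantAudit

/-! ### §G4 Secant audit (kit job `j009174`): the exact identities Lean can hold

The computation itself (256-dimensional exterior algebras over `ℚ(√D)`, spinor inversion for `η_P`,
contraction ranks) lives in `secant_audit.py`; here are the arithmetic facts it rests on or outputs,
and the `𝔽₂`-obstruction that kills the card's `ℚ(i)` untwisting, stated so that `decide` checks it. -/

/-- Gram discriminants of the secant planes (Mukai pairing `⟨(r,c,s),(r',c',s')⟩ = cc' − rs' − r's`):
`⟨𝓘_x, L𝓘_y⟩`: `[[2,1],[1,2]]`, disc `3` (`K = ℚ(√−3)`); the card's `ℚ(i)` data `v₁ = (1,A,5)`,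
`v₂ = (1,B,0)` (`A² = 12`, `B² = 4`, `A·B = 7`): `[[2,2],[2,4]]`, disc `4`; the SAME data with `v₁^∨`
put into the plane: `[[2,−12],[−12,4]]`, disc `−136 < 0` (indefinite — the kernel carries `v₁^∨`, the
plane does not); the rank-0 orthogonal pair `⟨𝓘_x, B𝓘_y⟩`: `diag(2,2)`, disc `4`. -/
theorem secant_discriminants :
    (2 : ℤ) * 2 - 1 * 1 = 3 ∧ (2 : ℤ) * 4 - 2 * 2 = 4 ∧ (2 : ℤ) * 4 - (-12) * (-12) = -136 ∧
      (2 : ℤ) * 2 - 0 * 0 = 4 := by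
  norm_num

/-- The Mukai vectors of the `ℚ(i)` data: `A = 3f₁+2f₂`, `B = 2f₁+f₂` on the hyperbolic plane
`⟨f₁,f₂⟩` (`fᵢ² = 0`, `f₁f₂ = 1`): `A² = 12`, `B² = 4`, `A·B = 7`; `v(𝓘_y ⊗ A) = (1, A, A²/2 − 1) =
(1,A,5)`, `v² = A² − 2·5 = 2`; `v(𝓘_{x,x+τ} ⊗ B) = (1, B, B²/2 − 2) = (1,B,0)`, `v² = 4`; pairing
`A·B − 1·0 − 1·5 = 2`; ranks of the Orlov images `∫ v₁^∨v₂`: `−(A·B) + 5 = −2` (card), `0·… :`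
`𝓘_x` vs `L𝓘_y`: `0 − 1·0 − … = −1`; χ of the images: `4`, `8`, `4` (products of `vᵢ²`). -/
theorem qi_data_arithmetic :
    2 * (3 * 2) = 12 ∧ 2 * (2 * 1) = 4 ∧ 3 * 1 + 2 * 2 = 7 ∧ (12 : ℤ) / 2 - 1 = 5 ∧
      (12 : ℤ) - 2 * 5 = 2 ∧ (4 : ℤ) / 2 - 2 = 0 ∧ (7 : ℤ) - 0 - 5 = 2 ∧ -(7 : ℤ) + 5 = -2 ∧
      (2 : ℤ) * 2 = 4 ∧ (2 : ℤ) * 4 = 8 := by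
  norm_num

/-- Spinor-side eigenvalues: `J_P² = −disc(P)` on `P`, so under the half-spin representation the
preimage `η = ρ⁻¹(J_P)` has `η² = −disc/4` on `V` (weights `±½(…)`): `−3/4` for `ℚ(√−3)` (rescale by
`2`: `(2η)² = −3`) and `−4/4 = −1` for `ℚ(i)` — as the job found. -/
theorem eta_normalisation : (2 : ℚ) ^ 2 * (-3 / 4) = -3 ∧ (-(4 : ℚ)) / 4 = -1 := by norm_num

/-- `κ(G)` for the `N = 1`, `ℚ(√−3)` seed, as output by the job in the normalisation `Ξ_P⁴ = 3456·pt`: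
`κ = −1 + Ξ²/24 + (w₊+w₋)/3 + Ξ³/144 + 2·pt`. Consistency of the Lefschetz part with `χ(G,G) = 4 =
∫κ^∨κ = 2κ₀κ₄ + ∫κ₂² (κ₁ = κ₃-pairing absent since κ₁ = 0)`: `2·(−1)·2 + 3456/24² = −4 + 6 = 2`, so the
Weil part contributes `∫((w₊+w₋)/3)² = 2`, i.e. `∫w₊w₋ = 9` in the job's eigenbasis. -/
theorem kappa_bookkeeping :
    (2 : ℚ) * (-1) * 2 + 3456 / (24 * 24) = 2 ∧ (4 : ℚ) - 2 = 2 ∧ (2 : ℚ) / 9 * 9 = 2 := by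
  norm_num

/-- The seven coordinates of `H²(X,𝔽₂) = Λ²H¹(X,𝔽₂)` on which `c₁(𝓔)` or `Ξ_P` is odd, in the
order `[f₂, a₁a₁^∨, b₁b₁^∨, a₂a₂^∨, b₂b₂^∨, a₁^∨b₁^∨, a₂^∨b₂^∨]` (job `j009174`, part B:
`c₁(𝓔) = 10f₁ + 5f₂ − 2a₁a₁^∨ − 2b₁b₁^∨ + a₂a₂^∨… wait signs irrelevant mod 2`): `c₁(𝓔) mod 2`. -/
def qiCOneBar : Fin 7 → ZMod 2 := ![1, 0, 0, 1, 1, 1, 1]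

/-- `Ξ_P mod 2` on the same seven coordinates (all other coordinates of both classes are even). -/
def qiXiBar : Fin 7 → ZMod 2 := ![1, 1, 1, 0, 0, 1, 1]

/-- **(F2) fails: the 𝔽₂-obstruction.** No `λ ∈ 𝔽₂` has `c₁(𝓔) ≡ λ·Ξ_P (mod 2)`; since odd multiples
`u·c₁` (det-twists `𝓔 ⊗ det^k`, `u = 1 − 2k… = 1+rk`) reduce to `c₁ mod 2` and line-bundle twists of
the rank `∓2` sheaf move `c₁` by `2NS`, NO untwisting `𝓔 ⊗ M` has `c₁ ∝ Ξ_P`: the degree-1 Hodge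
condition fails at every very general point of the `(η_P, Ξ_P)` Weil disc, upstairs on `X = S×Ŝ` and
(D4, pull-back of an even class is even) on `X'_k = X_k/Ḡ`. [computed: kit job j009174] -/
theorem F2_parity_obstruction : ∀ l : ZMod 2, qiCOneBar ≠ l • qiXiBar := by
  decide

/-- The same obstruction for the `f₁ ↔ f₂`-swapped data (`A = 2f₁+3f₂`, `B = f₁+2f₂`; job part B''):
odd supports `c₁ ↦ {f₁, a₁a₁^∨, b₁b₁^∨, a₁^∨b₁^∨, a₂^∨b₂^∨}`, `Ξ ↦ {f₁, a₂a₂^∨, b₂b₂^∨, a₁^∨b₁^∨,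
a₂^∨b₂^∨}` — the roles of the two index blocks are exchanged, the mismatch persists. -/
theorem F2_parity_obstruction_swapped :
    ∀ l : ZMod 2, (![1, 1, 1, 0, 0, 1, 1] : Fin 7 → ZMod 2) ≠ l • (![1, 0, 0, 1, 1, 1, 1]) := by
  decide

/-- The `ℚ(i)` numerical types of the scan (§G4bis): with `v₁² = 2`, `v₂² ∈ {2,…,10}` even and
`c = ⟨v₁,v₂⟩`, `disc P = 2v₂² − c²` is `4` or `16` exactly for
`(c, v₂²) ∈ {(0,2), (∓2,4), (0,8), (∓4,10), (±2,10)}`. [computed: kit job j009762] -/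
theorem qi_numerical_types :
    ((Finset.Icc (-6 : ℤ) 6) ×ˢ ({2, 4, 6, 8, 10} : Finset ℤ)).filter
        (fun p => 2 * p.2 - p.1 ^ 2 = 4 ∨ 2 * p.2 - p.1 ^ 2 = 16) =
      {(0, 2), (-2, 4), (2, 4), (0, 8), (-4, 10), (-2, 10), (2, 10), (4, 10)} := by
  decide

/-- Why `ℚ(i)` forces EVEN rank on secant images: `v₂² = 2N` is even (abelian surfaces have even Mukai
lattice), the rank is `r = −⟨v₁,v₂⟩`, and `K = ℚ(i)` means `disc P = 4N − r²` is `4n²`; hence `2 ∣ r` — the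
untwisting congruence `c₁ ≡ λΞ_P (mod r)` is never vacuous there (contrast `m ≡ 3 (4)`: `r = ±1`). -/
theorem rank_even_of_qi_disc (N r n : ℤ) (h : 4 * N - r ^ 2 = 4 * n ^ 2) : Even r := by
  have h2 : (2 : ℤ) ∣ r ^ 2 := ⟨2 * N - 2 * n ^ 2, by linarith⟩
  exact even_iff_two_dvd.2 (Int.prime_two.dvd_of_dvd_pow h2)

end CycleTwo_SecantAudit

/-! ## Cycle 3 (2026-08-16, refuter-cdisprove-…-g3-0) -/

/-! ### §H1 Skeleton audit of line `isogeny-untwist-superspecial` (see the index; theorems T1–T3′ below) -/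

/-! VERBATIM COPY of Lines/isogeny-untwist-superspecial.lean lines 108–258 (file sha256 prefix 9f2d68135d05d1f7, 2026-08-16T01:39Z), namespace
renamed `…Disproof.SkeletonAudit.IUS` (the Lines module has no olean on the farm and cannot be imported). -/
namespace SkeletonAudit.IUS

open CategoryTheory CategoryTheory.Abelian AlgebraicGeometry Opposite
open scoped Isocrystal
open Literature.AlgebraicGeometry.Motives Literature.AlgebraicGeometry.Motives.WittScheme
open Literature.AlgebraicGeometry.HodgeTheory Literature.AlgebraicGeometry.Modules
open Literature.AlgebraicGeometry.Deformation
open Summit.HodgeConjecture.HodgeConjecture.Cruxes.SemiregularSeedsOnAnchors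


variable {p : ℕ} [Fact p.Prime] {k : Type u} [Field k] [CharP k p] [PerfectRing k p]

/-! ## σ for all coherent modules (data), pinned to the real maps on bundles -/

/-- The Buchweitz–Flenner semiregularity components for ALL `𝒪_X`-modules and ALL degrees, as data
(intended: `σ_q = tr(At^q ∘ −)/q!` through a finite locally free resolution / the Atiyah class in `D^b`;
the reflexive secant sheaves `Ē`, `E′` are not locally free, and the tree's real `sigmaZero/sigmaOne` need
`IsFiniteLocallyFree`). Source: Mathlib's `Ext²(E, E)` in `X.Modules` (real for every module); target: the real
`H^{q+2}(X, Ω^q)`. -/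
structure FullSigma (k : Type u) [Field k] where
  /-- `σ_q` on `Ext²(E, E)`, every module `E`, every `q` -/
  sigma : ∀ (X : SchemeOver k) (E : X.left.Modules) (q : ℕ), Ext.{u + 1} E E 2 →+ hodgeCohomology X q (q + 2)

/-- `E` is semiregular for the package `Φσ`: `⊕_{q < p} σ_q` is injective on `Ext²(E, E)`. -/
def IsSemiregularData (Φσ : FullSigma k) (p : ℕ) (X : SchemeOver k) (E : X.left.Modules) : Prop :=
  ∀ x : Ext.{u + 1} E E 2, (∀ q : ℕ, q < p → Φσ.sigma X E q x = 0) → x = 0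

/-- `Φσ` is PINNED to the real maps (and to `Θ` in degrees `≥ 2`): on finite locally free modules, being
semiregular for `Φσ` is the typed crux's `IsPadicSemiregular Θ p` (real `σ₀, σ₁`). The intended `Φσ` satisfies
this (its degree-`0,1` components on bundles ARE `sigmaZero`, `sigmaOne`). -/
def FullSigma.PinnedTo (Φσ : FullSigma k) (Θ : HigherSigma k) (p : ℕ) : Prop :=
  ∀ (X : SchemeOver k) (E : X.left.Modules) (hE : IsFiniteLocallyFree E),
    IsSemiregularData Φσ p X E ↔ IsPadicSemiregular Θ p X hE

/-! ## The objects the stubs are stated over -/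

/-- **Family Hodge ring** of a special fibre `A/k` (intended: Markman's `Spin(V)_P`-invariant ring
`R_P = K[Ξ_P] ⊕ HW_P ⊂ ⊕_r H^{2r}_cris(A)_K` of the `K`-secant Weil datum, transported to the FM dual and read on
`A` — the classes that stay Hodge on EVERY member of the secant Weil family; arXiv:2502.03415 Cor. 1.3.2): a class
`Ξ ∈ H²(A)` and `K`-subspaces `inv r ⊂ H^{2r}(A)` containing `Ξ^r`. -/
structure FamilyHodgeRing (C : CrystallineRealization p k) (A : SchemeOver k) where
  /-- the polarisation class `Ξ` of the family -/
  Xi : C.obj A 2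
  /-- the degree-`2r` piece of the family Hodge ring -/
  inv : ∀ r : ℕ, Submodule K(p, k) (C.obj A (2 * r))
  /-- `Ξ^r ∈ inv r` -/
  pow_mem : ∀ r : ℕ, C.pow A Xi r ∈ inv r

/-- `𝒳/W` is a LIFT IN THE FAMILY of `R` (a family Hodge ring of its own special fibre): Berthelot–Ogus carries
`R` into the Hodge filtration of `X_K`, and the powers of `Ξ` become Lefschetz classes of `X_K` (`Ξ` lifts:
Berthelot–Ogus 3.8 + Grothendieck existence for the ample line bundle). -/
def FamilyHodgeRing.StaysHodgeOn {C : CrystallineRealization p k} {𝒳 : SchemeOver (WittVector p k)}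
    (R : FamilyHodgeRing C (specialFibre 𝒳)) : Prop :=
  (∀ (r : ℕ) (x : C.obj (specialFibre 𝒳) (2 * r)), x ∈ R.inv r →
      C.bo 𝒳 (2 * r) x ∈ C.dR.fil (2 * r) r) ∧
    ∀ r : ℕ, C.bo 𝒳 (2 * r) (C.pow (specialFibre 𝒳) R.Xi r) ∈ C.dR.lefschetzClasses (genericFibre 𝒳) r

/-- **Secant site** on a special fibre `A/k` (intended instance in the module docstring: `A` a superspecial
abelian sixfold carrying Markman's `Y` and, through `Ŷ ≅ Y ≅ A`, its dual). DATA: the level `N` and `[N]`; the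
reflexive descended secant sheaves `Ebar i` (secant and swapped secant) with their untwisting line bundles
`M i`; the FINAL SEEDS `E i = Φ_𝒫(([N]^*Ēᵢ ⊗ Mᵢ) ⊗ Ξ^m)`; the family Hodge ring `R`. PROPERTY FIELDS = the paper
theorems the existence stub must deliver on the superspecial fibre: `Ē` semiregular (Markman §9.3 transported to
characteristic `p`); LEVEL ORTHOGONALITY `Ext^•(Ēᵢ, Ēᵢ ⊗ P) = 0` for every line bundle `P ≇ 𝒪` with `[N]^*P ≅ 𝒪`
(F1, REAL carriers); the FM transport of semiregularity from `E′ᵢ` to the bundle `E i` (IT₀ + derived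
invariance); `ch(E i) ∈ R` in all degrees and the reach `R^{(r)} ≤ K·{ch_r(E i)} + K·Ξ^r` (Thm 1.4.1 (3),(4)
transported by `Φ^H`). -/
structure SecantSite (C : CrystallineRealization p k) (Θ : HigherSigma k) (Φσ : FullSigma k)
    (A : SchemeOver k) where
  /-- finite index of the seed family (secant, swapped secant, …) -/
  ι : Type
  [fintype : Fintype ι]
  /-- the level -/
  N : ℕ
  N_ne_zero : N ≠ 0
  /-- prime to `p` (so `[N]` is étale) -/
  not_dvd : ¬ p ∣ N
  /-- multiplication by `N` on the abelian variety `A`, as a `k`-morphism -/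
  mulN : A ⟶ A
  /-- the family Hodge ring (of the dual secant Weil datum, read on `A`) -/
  R : FamilyHodgeRing C A
  /-- the reflexive descended secant sheaves `Ēᵢ` -/
  Ebar : ι → A.left.Modules
  /-- `Ēᵢ` is semiregular (Markman), for the σ-data -/
  semiregularBar : ∀ i, IsSemiregularData Φσ p A (Ebar i)
  /-- the untwisting line bundles `Mᵢ` (`rk·c₁(Mᵢ) = −N²c₁(Ēᵢ)`) -/
  M : ι → A.left.Modules
  hasRankM : ∀ i, HasRank (M i) 1
  /-- LEVEL ORTHOGONALITY (F1): `Extⁿ(Ēᵢ, Ēᵢ ⊗ P) = 0` for every line bundle `P ≇ 𝒪` with `[N]^*P ≅ 𝒪` -/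
  levelOrthogonal : ∀ (i : ι) (P : A.left.Modules), HasRank P 1 →
    Nonempty ((Scheme.Modules.pullback mulN.left).obj P ≅ unitModule A.left) →
    IsEmpty (P ≅ unitModule A.left) → ∀ n : ℕ, Subsingleton (obstructionGroup n (Ebar i) P)
  /-- the final seeds `E″ᵢ` (FM transforms of the untwisted sheaves), bundles -/
  E : ι → A.left.Modules
  finiteLocallyFree : ∀ i, IsFiniteLocallyFree (E i)
  /-- FM TRANSPORT: if the untwisted `E′ᵢ = [N]^*Ēᵢ ⊗ Mᵢ` is semiregular (σ-data) then the bundle `E″ᵢ` is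
  p-adically semiregular on the real carriers (derived invariance of σ under `Φ_𝒫 ∘ (⊗ Ξ^m)` + pinning) -/
  transport : ∀ i,
    IsSemiregularData Φσ p A (tensorObj ((Scheme.Modules.pullback mulN.left).obj (Ebar i)) (M i)) →
      IsPadicSemiregular Θ p A (finiteLocallyFree i)
  /-- `ch(E″ᵢ) ∈ R` in every degree (`= Φ^H([N]^*κ(Ēᵢ)·e^{mΞ})`, family-Hodge on the dual family) -/
  ch_mem : ∀ (i : ι) (r : ℕ), C.chCris A (E i) r ∈ R.inv r
  /-- reach: `R` is spanned by the `ch(E″ᵢ)` and the powers of `Ξ` -/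
  reach : ∀ r : ℕ, R.inv r ≤
    Submodule.span K(p, k) (Set.range fun i => C.chCris A (E i) r) ⊔ Submodule.span K(p, k) {C.pow A R.Xi r}

attribute [instance] SecantSite.fintype

namespace SecantSite

variable {C : CrystallineRealization p k} {Θ : HigherSigma k} {Φσ : FullSigma k} {A : SchemeOver k}

/-- The UNTWISTED SHEAF `E′ᵢ := [N]^*Ēᵢ ⊗ Mᵢ` (the lever's output; reflexive). -/
def untwist (S : SecantSite C Θ Φσ A) (i : S.ι) : A.left.Modules :=
  tensorObj ((Scheme.Modules.pullback S.mulN.left).obj (S.Ebar i)) (S.M i)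

end SecantSite

/-! ## Stub statements (closed over the same parameters as the typed crux, plus the σ-data `Φσ`) -/

/-- Statement of `stub_secantSite`. -/
def SecantSiteExistence [IsAlgClosed k] (C : CrystallineRealization p k) (Θ : HigherSigma k)
    (Φσ : FullSigma k) : Prop :=
  Φσ.PinnedTo Θ p → 13 ≤ p → ∀ B : AbelianVariety k, B.dim = 6 →
    (∃ E₀ : AbelianVariety k, E₀.IsSupersingularEllipticCurve ∧ Nonempty (B ≅ E₀.powSucc 5)) →
    Nonempty (SecantSite C Θ Φσ B.X)

/-- Statement of `stub_isogenyDecomposition` (THE LEVER): for `E′ = [N]^*Ē ⊗ M` there is a decomposition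
`Ext²(E′, E′) ≃ Ext²(Ē, Ē) × T` (intended `T = ⊕_{τ ≠ 0} Ext²(Ē, Ē ⊗ P_τ)`: `[N]_*[N]^* = ⊕_τ (− ⊗ P_τ)` and
adjunction, transported along `− ⊗ M`) such that (1) `T = 0` when all `Ext²(Ē, Ē ⊗ P_τ)`, `τ ≠ 0`, vanish;
(2) every `σ_q(E′)` kills the off-diagonal summand (target `H^{q+2}(Ω^q ⊗ P_τ) = 0` / equivariance with invariant
target); (3) on the diagonal summand the JOINT kernels (`q < p`) of `σ(E′)` and `σ(Ē)` correspond (`[N]^*`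
injective on `H^b(Ω^a)`, BF Rem. 4.7(1), `exp(At M) ∪ −` unipotent). -/
def IsogenyDecomposition (C : CrystallineRealization p k) (Θ : HigherSigma k) (Φσ : FullSigma k) : Prop :=
  ∀ (A : SchemeOver k) (S : SecantSite C Θ Φσ A) (i : S.ι),
    ∃ (T : Type (u + 1)) (_ : AddCommGroup T)
      (e : Ext.{u + 1} (S.untwist i) (S.untwist i) 2 ≃+ Ext.{u + 1} (S.Ebar i) (S.Ebar i) 2 × T),
      ((∀ P : A.left.Modules, HasRank P 1 →
          Nonempty ((Scheme.Modules.pullback S.mulN.left).obj P ≅ unitModule A.left) →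
          IsEmpty (P ≅ unitModule A.left) → Subsingleton (obstructionGroup 2 (S.Ebar i) P)) →
        Subsingleton T) ∧
      (∀ (t : T) (q : ℕ), Φσ.sigma A (S.untwist i) q (e.symm (0, t)) = 0) ∧
      (∀ y : Ext.{u + 1} (S.Ebar i) (S.Ebar i) 2,
        (∀ q : ℕ, q < p → Φσ.sigma A (S.untwist i) q (e.symm (y, 0)) = 0) ↔
          (∀ q : ℕ, q < p → Φσ.sigma A (S.Ebar i) q y = 0))

/-- **The scope of the line** at `(𝒳, r, α)`: the special fibre carries a secant site whose family Hodge ring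
stays Hodge on `𝒳` (`𝒳_K` is a member of the secant Weil family) and reaches `α` modulo Lefschetz classes:
`α ∈ K·bo(R^{(r)}) + Lef^r(X_K)`. -/
def InSecantScope (C : CrystallineRealization p k) (Θ : HigherSigma k) (Φσ : FullSigma k)
    (𝒳 : SchemeOver (WittVector p k)) (r : ℕ) (α : C.dR.obj (genericFibre 𝒳) (2 * r)) : Prop :=
  ∃ S : SecantSite C Θ Φσ (specialFibre 𝒳), S.R.StaysHodgeOn ∧
    α ∈ Submodule.span K(p, k) (C.bo 𝒳 (2 * r) '' (S.R.inv r : Set (C.obj (specialFibre 𝒳) (2 * r)))) ⊔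
      C.dR.lefschetzClasses (genericFibre 𝒳) r

/-- Statement of `stub_residualOffSecantScope`: the crux OFF the scope of this line (RESIDUAL). -/
def ResidualOffSecantScope [IsAlgClosed k] (C : CrystallineRealization p k) (Θ : HigherSigma k)
    (Φσ : FullSigma k)
    (HO : ∀ ⦃𝒳 : SchemeOver (WittVector p k)⦄ ⦃i : ℕ⦄, C.dR.obj (genericFibre 𝒳) i → Prop) : Prop :=
  ∀ (n : ℕ) (𝒳 : SchemeOver (WittVector p k)), IsPadicAnchor C n 𝒳 →
    ∀ (r : ℕ) (α : C.dR.obj (genericFibre 𝒳) (2 * r)),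
      α ∈ C.dR.fil (2 * r) r →
      (∃ x ∈ C.tateClasses (specialFibre 𝒳) r, C.bo 𝒳 (2 * r) x = α) →
      HO α → ¬ InSecantScope C Θ Φσ 𝒳 r α → SeedSpan C Θ 𝒳 r α

/-! ### Audit theorems (refuter cdisprove cycle 3) -/

section Audit

variable {C : CrystallineRealization p k} {Θ : HigherSigma k} {Φσ : FullSigma k}

/-- **T1. The HARDEST stub is vacuous.** `stub_secantSite` / `SecantSiteExistence` is inhabited by the EMPTY
site: index type `PEmpty`, level `N = 1`, `[N] := 𝟙`, family Hodge ring `⟨0, r ↦ K ∙ 0^r⟩`. No hypothesis of the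
stub is used. Hence the registered "XL, HARDEST" stub carries no typed content: everything the line card puts
there (placement, Markman transplant, level orthogonality F1, FM bundling) lives only in the docstring. -/
theorem secantSiteExistence_trivial [IsAlgClosed k] (C : CrystallineRealization p k) (Θ : HigherSigma k)
    (Φσ : FullSigma k) : SecantSiteExistence C Θ Φσ := by
  intro _ _ B _ _
  refine ⟨{ ι := PEmpty, N := 1, N_ne_zero := one_ne_zero, not_dvd := ?_, mulN := 𝟙 _,
            R := ⟨0, fun r => Submodule.span K(p, k) {C.pow B.X 0 r}, fun _ => Submodule.subset_span rfl⟩,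
            Ebar := fun i => i.elim, semiregularBar := fun i => i.elim, M := fun i => i.elim,
            hasRankM := fun i => i.elim, levelOrthogonal := fun i => i.elim, E := fun i => i.elim,
            finiteLocallyFree := fun i => i.elim, transport := fun i => i.elim,
            ch_mem := fun i => i.elim, reach := fun _ => ?_ }⟩
  · intro h
    exact (Fact.out : p.Prime).one_lt.ne' (Nat.dvd_one.mp h)
  · exact le_sup_right

/-- The empty site exists on EVERY `k`-scheme (not only superspecial sixfolds), for every `C Θ Φσ`. -/
theorem secantSite_nonempty (C : CrystallineRealization p k) (Θ : HigherSigma k) (Φσ : FullSigma k)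
    (A : SchemeOver k) : Nonempty (SecantSite C Θ Φσ A) :=
  ⟨{ ι := PEmpty, N := 1, N_ne_zero := one_ne_zero,
     not_dvd := fun h => (Fact.out : p.Prime).one_lt.ne' (Nat.dvd_one.mp h), mulN := 𝟙 _,
     R := ⟨0, fun r => Submodule.span K(p, k) {C.pow A 0 r}, fun _ => Submodule.subset_span rfl⟩,
     Ebar := fun i => i.elim, semiregularBar := fun i => i.elim, M := fun i => i.elim,
     hasRankM := fun i => i.elim, levelOrthogonal := fun i => i.elim, E := fun i => i.elim,
     finiteLocallyFree := fun i => i.elim, transport := fun i => i.elim,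
     ch_mem := fun i => i.elim, reach := fun _ => le_sup_right }⟩

/-- **T2. The LEVER stub is a property of the σ-DATA, refutable by re-decoration.** Under
`IsogenyDecomposition C Θ Φσ`, any site whose untwisted sheaf `E′ᵢ = [N]^*Ēᵢ ⊗ Mᵢ` carries ZERO σ-data in all
degrees `q < p` has `Ext²(Ēᵢ, Ēᵢ) = 0`. So for a package `Φσ` that is the intended one except that it is `0` on the
single module `E′ᵢ` of Markman's site (where `ext²(Ē, Ē) ≫ 0`), the stub is FALSE; no naturality of `Φσ` under
the isomorphism `𝟙^*Ē ⊗ 𝒪 ≅ Ē` (or under `[N]^*`, `⊗ M`) is part of the typed statement. Corrected signature: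
quantify `Φσ` under a naturality hypothesis (`σ` commutes with isomorphisms of modules, with finite étale pull-back
and with twists by line bundles — Buchweitz–Flenner Rem. 4.7(1)), or make the decomposition a FIELD of the site. -/
theorem subsingleton_ext_of_isogenyDecomposition_of_sigma_untwist_eq_zero
    (h : IsogenyDecomposition C Θ Φσ) {A : SchemeOver k} (S : SecantSite C Θ Φσ A) (i : S.ι)
    (hzero : ∀ q : ℕ, q < p → ∀ z : Ext.{u + 1} (S.untwist i) (S.untwist i) 2,
      Φσ.sigma A (S.untwist i) q z = 0) :
    ∀ y : Ext.{u + 1} (S.Ebar i) (S.Ebar i) 2, y = 0 := by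
  intro y
  obtain ⟨T, _, e, _, _, hdiag⟩ := h A S i
  have hy : ∀ q : ℕ, q < p → Φσ.sigma A (S.Ebar i) q y = 0 :=
    (hdiag y).1 fun q hq => hzero q hq _
  exact S.semiregularBar i y hy

/-- Contrapositive of T2: a site with zero σ-data on some `E′ᵢ` and a non-zero class in `Ext²(Ēᵢ, Ēᵢ)` refutes
the lever stub for that package. (`H → ¬ stub`, `H` = such a site; `H` is inhabited by re-decorating the intended
package at one module, as soon as ANY sheaf with `Ext² ≠ 0` is semiregular for the intended σ — e.g. `𝒪_A` on an
abelian surface, `Ext²(𝒪,𝒪) = H²(𝒪) = k`, `σ₀ = Tr = id`.) -/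
theorem not_isogenyDecomposition_of_witness {A : SchemeOver k} (S : SecantSite C Θ Φσ A) (i : S.ι)
    (hzero : ∀ q : ℕ, q < p → ∀ z : Ext.{u + 1} (S.untwist i) (S.untwist i) 2,
      Φσ.sigma A (S.untwist i) q z = 0)
    (y : Ext.{u + 1} (S.Ebar i) (S.Ebar i) 2) (hy : y ≠ 0) : ¬ IsogenyDecomposition C Θ Φσ :=
  fun h => hy (subsingleton_ext_of_isogenyDecomposition_of_sigma_untwist_eq_zero h S i hzero y)

/-- **T3. The SCOPE predicate is not geometric: every seed family is a site.** If `Φσ` is pinned to the real maps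
on bundles, then ANY witness of the crux's conclusion `SeedSpan C Θ 𝒳 r α` (finitely many p-adically semiregular
bundles with the Hodge condition reaching `α` mod Lefschetz) can be PACKAGED as a secant site on `X_k` reaching
`α`: index the seeds themselves as `Ēᵢ = E″ᵢ`, `N = 1`, `[N] = 𝟙`, `Mᵢ = 𝒪`, `R^{(r)} = K⟨ch_r(E″ᵢ)⟩ + K·Ξ^r`.
Hence `InSecantScope C Θ Φσ 𝒳 r α ⊇ SeedSpan C Θ 𝒳 r α` for every `(𝒳, r, α)`: the "scope of the line" contains
every instance where the crux HOLDS, on every anchor (Fermat, K3^{[2]}, cubic fourfolds included), and the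
registered RESIDUAL stub `stub_residualOffSecantScope` only ever speaks about `(𝒳, α)` at which the crux FAILS — it
is `∀ …, HO α → ¬(crux conclusion, packaged) → crux conclusion`, i.e. (with the lever, which gives scope ⊆ seed
span) EQUIVALENT TO THE WHOLE TYPED CRUX, not to "the crux off the secant anchors". The two side hypotheses are
bookkeeping facts about Mathlib/tree carriers, true and cheap but not needed verbatim elsewhere: `hid` (pull-back
along `𝟙` is the identity on line bundles up to isomorphism) and `hO` (`𝒪` has rank one); `hΞ` asks for one class
`Ξ` on `X_k` all of whose powers go to Lefschetz classes inside the Hodge filtration (the polarisation). -/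
theorem inSecantScope_of_seedSpan (hpin : Φσ.PinnedTo Θ p) (𝒳 : SchemeOver (WittVector p k))
    (hid : ∀ P : (specialFibre 𝒳).left.Modules, HasRank P 1 →
      Nonempty ((Scheme.Modules.pullback (𝟙 (specialFibre 𝒳) : specialFibre 𝒳 ⟶ specialFibre 𝒳).left).obj P ≅
        unitModule _) → Nonempty (P ≅ unitModule _))
    (hO : HasRank (unitModule (specialFibre 𝒳).left) 1)
    (hΞ : ∃ Ξ : C.obj (specialFibre 𝒳) 2, ∀ r : ℕ,
      C.bo 𝒳 (2 * r) (C.pow (specialFibre 𝒳) Ξ r) ∈ C.dR.lefschetzClasses (genericFibre 𝒳) r ∧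
      C.bo 𝒳 (2 * r) (C.pow (specialFibre 𝒳) Ξ r) ∈ C.dR.fil (2 * r) r)
    (r : ℕ) (α : C.dR.obj (genericFibre 𝒳) (2 * r)) (h : SeedSpan C Θ 𝒳 r α) :
    InSecantScope C Θ Φσ 𝒳 r α := by
  obtain ⟨m, E, hE, hsr, hα⟩ := h
  obtain ⟨Ξ, hΞ⟩ := hΞ
  let S : SecantSite C Θ Φσ (specialFibre 𝒳) :=
    { ι := Fin m, N := 1, N_ne_zero := one_ne_zero,
      not_dvd := fun h => (Fact.out : p.Prime).one_lt.ne' (Nat.dvd_one.mp h),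
      mulN := 𝟙 _,
      R := ⟨Ξ, fun s => Submodule.span K(p, k) (Set.range fun i => C.chCris (specialFibre 𝒳) (E i) s) ⊔
              Submodule.span K(p, k) {C.pow (specialFibre 𝒳) Ξ s},
            fun s => Submodule.mem_sup_right (Submodule.subset_span rfl)⟩,
      Ebar := E,
      semiregularBar := fun i => (hpin _ (E i) (hE i)).2 (hsr i).1,
      M := fun _ => unitModule _,
      hasRankM := fun _ => hO,
      levelOrthogonal := fun i P hP hN hne n => by
        exact (hne.false (hid P hP hN).some).elim,
      E := E, finiteLocallyFree := hE,
      transport := fun i _ => (hsr i).1,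
      ch_mem := fun i s => Submodule.mem_sup_left (Submodule.subset_span ⟨i, rfl⟩),
      reach := fun s => le_rfl }
  refine ⟨S, ⟨?_, fun s => (hΞ s).1⟩, ?_⟩
  · intro s x hx
    change x ∈ Submodule.span K(p, k) (Set.range fun i => C.chCris (specialFibre 𝒳) (E i) s) ⊔
        Submodule.span K(p, k) {C.pow (specialFibre 𝒳) Ξ s} at hx
    rw [Submodule.mem_sup] at hx
    obtain ⟨y, hy, z, hz, rfl⟩ := hx
    rw [map_add]
    refine Submodule.add_mem _ ?_ ?_
    · refine Submodule.span_induction (p := fun y _ => C.bo 𝒳 (2 * s) y ∈ C.dR.fil (2 * s) s) ?_ ?_ ?_ ?_ hy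
      · rintro _ ⟨i, rfl⟩
        exact (hsr i).2 s
      · simp
      · intro a b _ _ ha hb
        rw [map_add]
        exact Submodule.add_mem _ ha hb
      · intro c a _ ha
        rw [map_smul]
        exact Submodule.smul_mem _ c ha
    · rw [Submodule.mem_span_singleton] at hz
      obtain ⟨c, rfl⟩ := hz
      rw [map_smul]
      exact Submodule.smul_mem _ c (hΞ s).2
  · -- α ∈ span bo(R.inv r) ⊔ Lef, from hα : α ∈ span(range bo ch) ⊔ Lef
    have hsub : Submodule.span K(p, k)
          (Set.range fun i => C.bo 𝒳 (2 * r) (C.chCris (specialFibre 𝒳) (E i) r)) ≤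
        Submodule.span K(p, k)
          (C.bo 𝒳 (2 * r) '' (S.R.inv r : Set (C.obj (specialFibre 𝒳) (2 * r)))) := by
      refine Submodule.span_mono ?_
      rintro _ ⟨i, rfl⟩
      refine ⟨C.chCris (specialFibre 𝒳) (E i) r, ?_, rfl⟩
      change C.chCris (specialFibre 𝒳) (E i) r ∈
        Submodule.span K(p, k) (Set.range fun i => C.chCris (specialFibre 𝒳) (E i) r) ⊔
          Submodule.span K(p, k) {C.pow (specialFibre 𝒳) Ξ r}
      exact Submodule.mem_sup_left (Submodule.subset_span ⟨i, rfl⟩)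
    exact sup_le_sup_right hsub _ hα

/-- **T3′. Hence the RESIDUAL stub says "every crux instance is in scope".** With the packaging of T3,
`ResidualOffSecantScope C Θ Φσ HO` is EQUIVALENT to: at every anchor, every `φ`-Tate Hodge-origin class in the
filtration is `InSecantScope` — a statement about ALL anchors (Fermat, K3^{[2]}, cubic and Weil fourfolds, …), not
about "the complement of the superspecial-sixfold secant anchors". Combined with the lever (in scope ⇒ seed span)
it is the whole typed crux; in particular the residual stub is refuted by any counterexample to the crux anywhere,
and proving it is proving the crux. Recommendation to the lead / tenure planner: define the scope GEOMETRICALLY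
(`X_k` a superspecial abelian sixfold, `𝒳_K` in a Markman secant Weil family, `r = 3`, `α ∈ bo(KΞ³ ⊕ HW) + Lef`)
so that the residual is genuinely smaller, or split P2a by anchor class as all three triagers asked. -/
theorem residual_iff_forall_inSecantScope [IsAlgClosed k] (hpin : Φσ.PinnedTo Θ p)
    (hid : ∀ (𝒳 : SchemeOver (WittVector p k)) (P : (specialFibre 𝒳).left.Modules), HasRank P 1 →
      Nonempty ((Scheme.Modules.pullback (𝟙 (specialFibre 𝒳) : specialFibre 𝒳 ⟶ specialFibre 𝒳).left).obj P ≅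
        unitModule _) → Nonempty (P ≅ unitModule _))
    (hO : ∀ 𝒳 : SchemeOver (WittVector p k), HasRank (unitModule (specialFibre 𝒳).left) 1)
    (hΞ : ∀ (n : ℕ) (𝒳 : SchemeOver (WittVector p k)), IsPadicAnchor C n 𝒳 →
      ∃ Ξ : C.obj (specialFibre 𝒳) 2, ∀ r : ℕ,
        C.bo 𝒳 (2 * r) (C.pow (specialFibre 𝒳) Ξ r) ∈ C.dR.lefschetzClasses (genericFibre 𝒳) r ∧
        C.bo 𝒳 (2 * r) (C.pow (specialFibre 𝒳) Ξ r) ∈ C.dR.fil (2 * r) r)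
    (HO : ∀ ⦃𝒳 : SchemeOver (WittVector p k)⦄ ⦃i : ℕ⦄, C.dR.obj (genericFibre 𝒳) i → Prop) :
    ResidualOffSecantScope C Θ Φσ HO ↔
      ∀ (n : ℕ) (𝒳 : SchemeOver (WittVector p k)), IsPadicAnchor C n 𝒳 →
        ∀ (r : ℕ) (α : C.dR.obj (genericFibre 𝒳) (2 * r)),
          α ∈ C.dR.fil (2 * r) r →
          (∃ x ∈ C.tateClasses (specialFibre 𝒳) r, C.bo 𝒳 (2 * r) x = α) →
          HO α → InSecantScope C Θ Φσ 𝒳 r α := by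
  constructor
  · intro hres n 𝒳 h𝒳 r α hfil hT hHO
    by_contra hs
    exact hs (inSecantScope_of_seedSpan hpin 𝒳 (hid 𝒳) (hO 𝒳) (hΞ n 𝒳 h𝒳) r α
      (hres n 𝒳 h𝒳 r α hfil hT hHO hs))
  · intro hall n 𝒳 h𝒳 r α hfil hT hHO hs
    exact absurd (hall n 𝒳 h𝒳 r α hfil hT hHO) hs

end Audit

end SkeletonAudit.IUS


section CycleThree_FermatSextic

/-! ### §H2 The Fermat sextic fourfold anchor: Lemma B exact, ρ-table, and the second-order obstruction

All statements of this section are the ARITHMETIC / COMBINATORIAL shadows of the index item §H2; the linear algebra (ranks,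
kernels, trilinear forms) is kit job `j010476` (`comp/run.sh`: `sextic_rho.py`, `sextic_containment.py`, `sextic_obstruction.py`,
pure python3, exact arithmetic mod `11`, `37`, `1009`, `10⁶+3`; CONTROL: the plane class is unobstructed, as Movasati–Villaflor prove).

THE GERM ARGUMENT (paper, characteristic-free; recorded here because the provers can use it positively). `X/k` smooth projective
with `ω_X ≅ 𝒪`, `H²(𝒪) = H⁰(Λ²T) = 0` (so `HT²(X) = H¹(T_X)`), unobstructed deformations, and a Jacobian/IVHS description of
`(H_dR, F, ∇)` to first order (Fermat sextic, `p ≥ 11`). For `E ∈ D^b(X)` perfect: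
(1) `⟨σ₁(x), ξ⟩_{Serre} = Tr((ξ ⌟ At_E) ∘ x) = ⟨x, ev(ξ)⟩`, so `σ₁ = evᵗ` and `σ₁` injective ⇔ `ev : H¹(T) → Ext²(E,E)` onto ⇔
`ext²(E,E) = rank(σ₁ ∘ ev) = rank(ξ ↦ ξ ⌟ ch₂(E)) = ρ(P_E)`. (2) If `ev` is onto, `Def(X, E)` is formally smooth: given a small
extension `A' ↠ A` (ideal `I`) and `(X_A, E_A)`, lift `X_A` to some `X_{A'}` (unobstructed), let `o ∈ Ext²(E,E) ⊗ I` be the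
obstruction to lifting `E_A`; replacing `X_{A'}` by `X_{A'} + ξ`, `ξ ∈ H¹(T) ⊗ I`, replaces `o` by `o + ev(ξ)` (Illusie), and
`ev ⊗ I` is onto. (3) The tangent map of `Def(X,E) → Def(X)` has image `ker ev = ker(σ₁ ∘ ev) = T(P_E)` (`σ₁` injective) and
kernel `Ext¹(E,E)`, so `dim Def(X,E) = ext¹ + dim T(P_E)`; for the local homomorphism of hulls `R_{Def X} → R_{Def(X,E)}` with
image `R_S` one has `dim R_{Def(X,E)} ≤ dim R_S + dim(fibre ring)` and `dim(fibre ring) ≤ embdim = ext¹(E,E)`, so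
`dim S_E ≥ dim T(P_E)`. (4) `S_E ⊆ H_{ch₂ E}` (Chern characters of deformations are horizontal and in `F²`) and
`T₀ H_{ch₂E} = T(P_E)` (Griffiths transversality / Katz–Oda). (5) A germ `H` of embedding dimension `d` containing a germ `S` of
dimension `≥ d`: `S ⊆ H ⊆ M` for a smooth `d`-dimensional `M`, so `S = H = M`. CONCLUSION: `E` semiregular ⇒ `H_{ch₂(E)}` is SMOOTH of
codimension `ρ(P_E)` at `X` (and `= S_E`: `E` deforms exactly over it). Contrapositive + (d): no semiregular `E` has a pure pair
class of an obstructed type. [Bloch 1972 / Buchweitz–Flenner 2003 / Pridham 2024 for the char-0 Hodge-theoretic route to the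
same conclusion; the argument above needs none of it because `ev` is onto.] -/

/-- The numbers of the sextic fourfold `X₆ ⊂ ℙ⁵`. Jacobian ring `R = k[x₀..x₅]/(xᵢ⁵)`: `dim R₆ = C(11,5) − 36 = 426`
(all degree-6 monomials minus `xᵢ⁵xⱼ` (30) and `xᵢ⁶` (6)) `= h^{3,1} = dim H¹(T)`; `dim R₁₂ = C(17,5) − 6·C(11,5) + 15·C(5,5)·…`
— inclusion–exclusion `6188 − 4752 + 315 = 1751 = h^{2,2}_prim`; `dim R₁₈ = 426` (`β ↦ 4 − β`). Chern classes
`c(X) = (1+h)⁶/(1+6h)`: `c₂ = 15h²`, `c₃ = −70h³`, `c₄ = 435h⁴`, `deg h⁴ = 6`, `e(X) = 2610`, `b₄ = 2606 = 2·1 + 2·426 + 1752`,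
`χ(𝒪_X) = td₄ = (3c₂² − c₄)/720 = (3·1350 − 2610)/720 = 2` (CY: `h^{0,0} + h^{0,4}`); semiregularity target
`τ = h^{0,2} + h^{1,3} + h^{2,4} = 0 + 426 + 0 = dim H¹(T)` — the only anchor class met so far where `τ = dim HT²` and `ω ≅ 𝒪`
simultaneously (Lemma B exact AND a single component `σ₁`). [folklore: Griffiths 1969; SGA 7 XI for char `p`] -/
theorem sextic_numbers :
    Nat.choose 11 5 - (30 + 6) = 426 ∧ (6188 : ℤ) - 6 * 792 + 15 * 21 = 1751 ∧ Nat.choose 17 5 = 6188 ∧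
      Nat.choose 12 5 = 792 ∧ Nat.choose 7 5 = 21 ∧
    (Nat.choose 6 2 = 15 ∧ Nat.choose 6 3 = 20 ∧ Nat.choose 6 4 = 15) ∧
      (15 : ℤ) - 36 + 36 = 15 ∧ (20 : ℤ) - 6 * 15 + 36 * 6 - 216 = -70 ∧
      (15 : ℤ) - 6 * 20 + 36 * 15 - 216 * 6 + 1296 = 435 ∧
    435 * 6 = 2610 ∧ 2610 - 4 = 2606 ∧ 2 * 1 + 2 * 426 + 1752 = 2606 ∧ (3 * (15 * 15 * 6) - 2610) / 720 = 2 ∧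
    0 + 426 + 0 = 426 := by
  refine ⟨by decide, by norm_num, by decide, by decide, by decide, by decide, by norm_num, by norm_num, by norm_num,
    by norm_num, by norm_num, by norm_num, by norm_num, by norm_num⟩

/-- The census of `(2,2)`-characters of `X⁴₆` (`a ∈ {1..5}⁶`, `Σ aᵢ = 18`; kit `j010476`/`sextic_rho.py`): `1751` characters in
`18` `S₆`-types / `14` up to sign; `1001` three-pair `+ 720` saturated non-pair `+ 30` unsaturated; the unsaturated ones are the
`15 + 15` characters of types `(1,1,4,4,4,4)` and `(2,2,2,2,5,5) = −(1,1,4,4,4,4)`, and `2·(1,1,4,4,4,4) = (2,2,2,2,2,2)` has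
`Σ = 12`, type `(3,1)`. Units of `ℤ/6` are `±1` and `Σ(−a) = 36 − 18`, so every `(2,2)`-character is totally Hodge. -/
theorem sextic_census :
    1001 + 720 + 30 = 1751 ∧ Nat.choose 6 2 = 15 ∧ (2 * 1) % 6 + (2 * 1) % 6 + 4 * ((2 * 4) % 6) = 12 ∧ 36 - 18 = 18 ∧
      1 + 1 + 4 + 4 + 4 + 4 = 18 ∧ 5 + 5 + 2 + 2 + 2 + 2 = 18 := by
  decide

/-- ρ-additivity and the tangent space of the unsaturated pair class `u = x^b + c·x^{b'}`, `b = (0,0,3,3,3,3)`,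
`b' = 4 − b = (4,4,1,1,1,1)`: `rank m_{x^b} = #{γ ≤ b', |γ| = 6} = Σ_{s=0}^{4} C(4,s)·#{γ₀+γ₁ = 6−s, γᵢ ≤ 4} = 3+16+30+16+3 = 68`,
`rank m_{x^{b'}} = #{γ ≤ b, |γ| = 6} = #{γ ∈ [0,3]⁴, Σ = 6} = C(9,3) − 4·C(5,3) = 44`; no `γ` of degree `6` divides both
(`min(b,b')` has degree `4`), so `T(u) = {x^γ : γ ∤ x^b, γ ∤ x^{b'}}` is MONOMIAL, `ρ(u) = 68 + 44 = 112` (kit: `112` for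
`c = 1,2,3`, mod `11` and mod `10⁶+3`) and `dim T(u) = 426 − 112 = 314`. -/
theorem sextic_unsaturated_rho :
    1 * 3 + 4 * 4 + 6 * 5 + 4 * 4 + 1 * 3 = 68 ∧ Nat.choose 9 3 - 4 * Nat.choose 5 3 = 44 ∧ 0 + 0 + 1 + 1 + 1 + 1 = 4 ∧
      68 + 44 = 112 ∧ 426 - 112 = 314 := by
  decide

/-- The exponent vectors of the obstruction witness for the unsaturated pair class. -/
def sexticB : Fin 6 → ℕ := ![0, 0, 3, 3, 3, 3]
/-- `b' = 4 − b`. -/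
def sexticB' : Fin 6 → ℕ := ![4, 4, 1, 1, 1, 1]
/-- Three monomials of `R₆`. -/
def sexticG₁ : Fin 6 → ℕ := ![2, 0, 2, 2, 0, 0]
def sexticG₂ : Fin 6 → ℕ := ![2, 0, 1, 1, 2, 0]
def sexticG₃ : Fin 6 → ℕ := ![2, 0, 0, 0, 1, 3]

/-- **Second-order obstruction witness** (index §H2 (d)). The three monomials `x^{γⱼ}` lie in `R₆` (degree `6`, exponents `≤ 4`)
and in the monomial tangent space `T(u)` of every pure pair class of the unsaturated type (`γⱼ` divides neither `x^b` nor
`x^{b'}`), and their product is `x^ν`, `ν = b + 6e₀ = (6,0,3,3,3,3)`: exactly ONE exponent exceeds `4`, it lies in `[5,10]`, and one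
Griffiths–Dwork carry gives `[x^ν Ω/F⁴] = ((6−5)/18)·[x^b Ω/F³]`, whose pairing with `u = λ·(x^b)^∨ + μ·(x^{b'})^∨` is `λ/18 ≠ 0`.
Hence the cubic obstruction form `τ_u(ξ,ξ,ξ) = C₃(ξ³)` on `T(u)` has the non-zero coefficient `6·λ/18` at
`ξ_{γ₁}ξ_{γ₂}ξ_{γ₃}` (distinct monomials, no other triple of `T(u)`-monomials can cancel a fixed monomial coefficient of a cubic in
independent coordinates): the Hodge locus of `u` is SINGULAR at the Fermat sextic point for every `(λ:μ)` with `λ ≠ 0`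
(symmetrically `μ ≠ 0` via `b' + 6e₂ = (4,4,7,1,1,1) = (0,2,3,0,1,0)+(2,2,2,0,0,0)+(2,0,2,1,0,1)`, second conjunct). The kit job
confirms `τ ≢ 0` numerically for `c ∈ {1,2,3}` and finds the same for 12 of the 14 pair types. -/
theorem sextic_obstruction_witness :
    ((∑ i, sexticG₁ i = 6 ∧ ∑ i, sexticG₂ i = 6 ∧ ∑ i, sexticG₃ i = 6) ∧
      (∀ i, sexticG₁ i ≤ 4 ∧ sexticG₂ i ≤ 4 ∧ sexticG₃ i ≤ 4) ∧
      (¬ (∀ i, sexticG₁ i ≤ sexticB i) ∧ ¬ (∀ i, sexticG₁ i ≤ sexticB' i)) ∧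
      (¬ (∀ i, sexticG₂ i ≤ sexticB i) ∧ ¬ (∀ i, sexticG₂ i ≤ sexticB' i)) ∧
      (¬ (∀ i, sexticG₃ i ≤ sexticB i) ∧ ¬ (∀ i, sexticG₃ i ≤ sexticB' i)) ∧
      (∀ i, sexticG₁ i + sexticG₂ i + sexticG₃ i = sexticB i + if i = 0 then 6 else 0) ∧
      (5 ≤ sexticB 0 + 6 ∧ sexticB 0 + 6 ≤ 10 ∧ ∀ i, i ≠ 0 → sexticB i ≤ 4)) ∧
    (∀ i, (![0, 2, 3, 0, 1, 0] : Fin 6 → ℕ) i + (![2, 2, 2, 0, 0, 0] : Fin 6 → ℕ) i + (![2, 0, 2, 1, 0, 1] : Fin 6 → ℕ) i =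
        sexticB' i + if i = 2 then 6 else 0) ∧
      (¬ (∀ i, (![0, 2, 3, 0, 1, 0] : Fin 6 → ℕ) i ≤ sexticB i) ∧ ¬ (∀ i, (![0, 2, 3, 0, 1, 0] : Fin 6 → ℕ) i ≤ sexticB' i) ∧
       ¬ (∀ i, (![2, 2, 2, 0, 0, 0] : Fin 6 → ℕ) i ≤ sexticB i) ∧ ¬ (∀ i, (![2, 2, 2, 0, 0, 0] : Fin 6 → ℕ) i ≤ sexticB' i) ∧
       ¬ (∀ i, (![2, 0, 2, 1, 0, 1] : Fin 6 → ℕ) i ≤ sexticB i) ∧ ¬ (∀ i, (![2, 0, 2, 1, 0, 1] : Fin 6 → ℕ) i ≤ sexticB' i)) := by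
  decide

/-- The Griffiths–Dwork constants used: one carry from pole order `4` costs `(νᵢ − 5)/(6·3)`; at `νᵢ = 6` this is `1/18 ≠ 0`, at
`νᵢ = 7` it is `2/18`, and at `νᵢ = 5` it is `0` (the class `[x^ν Ω/F⁴]` then has a character with a zero entry and vanishes in
primitive cohomology — the consistency check of the formalism). All are units for `p ≥ 11`. -/
theorem griffithsDwork_constants :
    ((6 : ℚ) - 5) / (6 * 3) = 1 / 18 ∧ ((7 : ℚ) - 5) / (6 * 3) = 1 / 9 ∧ ((5 : ℚ) - 5) / (6 * 3) = 0 ∧ (1 : ℚ) / 18 ≠ 0 ∧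
      Nat.Coprime 18 11 := by
  refine ⟨by norm_num, by norm_num, by norm_num, by norm_num, by decide⟩

/-- The dimension bookkeeping of the germ argument (index §H2 (e)) at the unsaturated pair: `dim Def(X,E) = ext¹ + 314`, fibre
embedding dimension `ext¹`, so `dim S_E ≥ 314 = embdim H_u`; a seed would make `H_u` smooth of dimension `314`, contradicting
(d). Stated as the arithmetic it is, for any `ext¹ = e`. -/
theorem germ_dimension_count (e : ℕ) : e + 314 - e = 426 - 112 := by
  omega

end CycleThree_FermatSextic

section CycleThree_Kill

/-! ### §H5 THE KILL (cycle 3): P2a is false at a very general point of a symmetric slice of the Hodge locus of the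
unsaturated pair class on the Fermat sextic fourfold — combinatorial certificate

Paper proof: `KILL.md` (attached as item evidence; index item "Cycle 3 — KILL"). The anchor: `p ≫ 0`, `p ≡ 5 (mod 6)`;
`X_k` = Fermat sextic fourfold; `Λ₁ ⊂ (ℤ/6)⁶` the subgroup below (order `162`); `D = Λ₁ ∩ R₆` the 23 invariant monomial
directions; `Z ⊂ 𝓕_D` the `p`-adic Hodge locus of the unsaturated pair class `u` (`a = (1,1,4,4,4,4)`) inside the `Λ₁^⊥`-symmetric
family — ONE equation, smooth, `T₀Z = {ξ_{(3,3,0,0,0,0)} = 0}`; `y ∈ Z(W)` very general; `α = bo_y(u)`. Then (KILL.md §4) `α` is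
`φ`-Tate on the nose and of Hodge origin, and (§5) every semiregular `E` with the Hodge condition at `𝒳_y` has
`supp(ch₂(E)_prim) ⊆ {b,b'} ∪ {c,c'}` and runs into one of four contradictions (three witness triples of the second-order
obstruction + the rigid case). What Lean checks here: the arithmetic of the certificate — membership of `D` and of `a` in `Λ₁`
(presented as a kernel of five characters; arithmetic in `Fin 6 = ℤ/6`), exclusion of the `(4,0)/(0,4)`-producing elements, the Hodge types of `2a, 4a`, the
equation direction, survival of `b, b', c, c'`, and the three witness triples (`native_decide`/`decide`, computational); the two
exhaustive enumerations over `(ℤ/6)⁶` resp. `[0,4]⁶` (coset census; confinement) are kit-certified only (`verify_kill.py`,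
`certify_slice.py`; see the note at the end of this section). -/

/-- The five characters cutting out `Λ₁ = {x : w·x = 0 (mod 6)}` (= the group generated by `(0,4,2,0,0,0)`, `(3,1,0,0,2,0)`,
`(2,0,0,0,0,4)`, `(1,1,0,2,2,0)`; double-annihilator computed in `comp/`, order `162`). -/
def killForms : List (Fin 6 → Fin 6) :=
  [![0, 2, 2, 0, 5, 0], ![2, 0, 0, 2, 0, 5], ![0, 0, 0, 3, 0, 0], ![0, 0, 3, 0, 0, 0], ![3, 3, 0, 0, 0, 0]]

/-- Membership in `Λ₁`. -/
def InKillLam (x : Fin 6 → Fin 6) : Prop :=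
  ∀ w ∈ killForms, w 0 * x 0 + w 1 * x 1 + w 2 * x 2 + w 3 * x 3 + w 4 * x 4 + w 5 * x 5 = 0

instance (x : Fin 6 → Fin 6) : Decidable (InKillLam x) := by
  unfold InKillLam; infer_instance

/-- The 23 invariant directions `D = Λ₁ ∩ R₆` (degree-6 monomials, exponents `≤ 4`). -/
def killD : List (Fin 6 → ℕ) :=
  [![0, 0, 0, 2, 0, 4], ![0, 0, 0, 4, 0, 2], ![0, 0, 2, 0, 4, 0], ![0, 0, 4, 0, 2, 0], ![0, 2, 0, 0, 4, 0], ![0, 2, 2, 0, 2, 0], ![0, 2, 4, 0, 0, 0], ![0, 4, 0, 0, 2, 0], ![0, 4, 2, 0, 0, 0], ![1, 1, 0, 0, 2, 2], ![1, 1, 0, 2, 2, 0], ![1, 1, 2, 0, 0, 2], ![1, 1, 2, 2, 0, 0], ![1, 3, 0, 0, 0, 2], ![1, 3, 0, 2, 0, 0], ![2, 0, 0, 0, 0, 4], ![2, 0, 0, 2, 0, 2], ![2, 0, 0, 4, 0, 0], ![3, 1, 0, 0, 2, 0], ![3, 1, 2, 0, 0, 0], ![3, 3, 0, 0, 0, 0],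 ![4, 0, 0, 0, 0, 2], ![4, 0, 0, 2, 0, 0]]

/-- The 22 free directions (`D` minus the equation direction `(3,3,0,0,0,0)`). -/
def killDfree : List (Fin 6 → ℕ) :=
  [![0, 0, 0, 2, 0, 4], ![0, 0, 0, 4, 0, 2], ![0, 0, 2, 0, 4, 0], ![0, 0, 4, 0, 2, 0], ![0, 2, 0, 0, 4, 0], ![0, 2, 2, 0, 2, 0], ![0, 2, 4, 0, 0, 0], ![0, 4, 0, 0, 2, 0], ![0, 4, 2, 0, 0, 0], ![1, 1, 0, 0, 2, 2], ![1, 1, 0, 2, 2, 0], ![1, 1, 2, 0, 0, 2], ![1, 1, 2, 2, 0, 0], ![1, 3, 0, 0, 0, 2], ![1, 3, 0, 2, 0, 0], ![2, 0, 0, 0, 0, 4], ![2, 0, 0, 2, 0, 2], ![2, 0, 0, 4, 0, 0], ![3, 1, 0, 0, 2, 0], ![3, 1, 2, 0, 0, 0], ![4, 0, 0, 0, 0, 2], ![4, 0, 0, 2, 0, 0]]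

/-- `D ⊂ R₆ ∩ Λ₁`: every listed direction has degree `6`, exponents `≤ 4`, and lies in `Λ₁`; `killDfree` is `killD` without
`(3,3,0,0,0,0)`. -/
theorem killD_sound :
    (∀ d ∈ killD, ∑ i, d i = 6 ∧ (∀ i, d i ≤ 4) ∧ InKillLam (fun i => (⟨d i % 6, Nat.mod_lt _ (by decide)⟩ : Fin 6))) ∧
    (∀ d ∈ killDfree, d ∈ killD ∧ d ≠ ![3, 3, 0, 0, 0, 0]) ∧ (![3, 3, 0, 0, 0, 0] : Fin 6 → ℕ) ∈ killD ∧
    killD.length = 23 ∧ killDfree.length = 22 := by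
  native_decide

/-- The class data: `a = (1,1,4,4,4,4) ∈ Λ₁` (so `a + Λ₁ = −a + Λ₁ ∋ 2a, 4a`); `2a = (2,2,2,2,2,2)` has `Σ = 12` (type `(3,1)`),
`4a = (4,4,4,4,4,4)` has `Σ = 24` (type `(1,3)`); the three elements whose presence would put a `(4,0)`/`(0,4)` character into the
cosets — `b̄ = (0,0,3,3,3,3)`, `b̄' = (4,4,1,1,1,1)`, `−b̄' = (2,2,5,5,5,5)` — are NOT in `Λ₁`; and the equation direction:
`b' − (2a − 1) = (4,4,1,1,1,1) − (1,1,1,1,1,1) = (3,3,0,0,0,0)` while `b − (1,…,1)` would need a negative entry. -/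
theorem kill_class_data :
    InKillLam ![1, 1, 4, 4, 4, 4] ∧ InKillLam ![2, 2, 2, 2, 2, 2] ∧ InKillLam ![4, 4, 4, 4, 4, 4] ∧
    (2 + 2 + 2 + 2 + 2 + 2 = 12 ∧ 4 + 4 + 4 + 4 + 4 + 4 = 24) ∧
    ¬ InKillLam ![0, 0, 3, 3, 3, 3] ∧ ¬ InKillLam ![4, 4, 1, 1, 1, 1] ∧ ¬ InKillLam ![2, 2, 5, 5, 5, 5] ∧
    (∀ i : Fin 6, (![4, 4, 1, 1, 1, 1] : Fin 6 → ℕ) i = (![3, 3, 0, 0, 0, 0] : Fin 6 → ℕ) i + 1) ∧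
    (![0, 0, 3, 3, 3, 3] : Fin 6 → ℕ) 0 < 1 := by
  native_decide

/-- `b, b', c, c'` SURVIVE the free directions (no free `γ` has `β + γ ≤ 4`): they are in the confinement set `S`. -/
theorem kill_survivors :
    ∀ γ ∈ killDfree,
      (∃ i, 4 < (![0, 0, 3, 3, 3, 3] : Fin 6 → ℕ) i + γ i) ∧ (∃ i, 4 < (![4, 4, 1, 1, 1, 1] : Fin 6 → ℕ) i + γ i) ∧
      (∃ i, 4 < (![0, 4, 1, 3, 1, 3] : Fin 6 → ℕ) i + γ i) ∧ (∃ i, 4 < (![4, 0, 3, 1, 3, 1] : Fin 6 → ℕ) i + γ i) := by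
  native_decide

/-- THE THREE WITNESS TRIPLES of the case analysis (KILL.md (C4)/(K3)); `S` = the support in each case; each monomial has
degree `6`, exponents `≤ 4`, divides no `x^s` (`s ∈ S`), and the sum is `s₀ + 6eᵢ` with a single exponent `≥ 5`, at most `10`. -/
theorem kill_witnesses :
    -- case 2: S = {b, b'}, target b + 6e₀
    (let g₁ : Fin 6 → ℕ := ![1, 0, 0, 0, 2, 3]; let g₂ : Fin 6 → ℕ := ![1, 0, 1, 3, 1, 0]; let g₃ : Fin 6 → ℕ := ![4, 0, 2, 0, 0, 0]
     let S : List (Fin 6 → ℕ) := [![0, 0, 3, 3, 3, 3], ![4, 4, 1, 1, 1, 1]]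
     (∑ i, g₁ i = 6 ∧ ∑ i, g₂ i = 6 ∧ ∑ i, g₃ i = 6) ∧ (∀ i, g₁ i ≤ 4 ∧ g₂ i ≤ 4 ∧ g₃ i ≤ 4) ∧
     (∀ s ∈ S, (∃ i, s i < g₁ i) ∧ (∃ i, s i < g₂ i) ∧ (∃ i, s i < g₃ i)) ∧
     (∀ i, g₁ i + g₂ i + g₃ i = (![0, 0, 3, 3, 3, 3] : Fin 6 → ℕ) i + if i = 0 then 6 else 0)) ∧
    -- case 1: S = {b, b', c, c'}, target b' + 6e₂
    (let g₁ : Fin 6 → ℕ := ![0, 1, 2, 1, 1, 1]; let g₂ : Fin 6 → ℕ := ![1, 2, 3, 0, 0, 0]; let g₃ : Fin 6 → ℕ := ![3, 1, 2, 0, 0, 0]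
     let S : List (Fin 6 → ℕ) := [![0, 0, 3, 3, 3, 3], ![4, 4, 1, 1, 1, 1], ![0, 4, 1, 3, 1, 3], ![4, 0, 3, 1, 3, 1]]
     (∑ i, g₁ i = 6 ∧ ∑ i, g₂ i = 6 ∧ ∑ i, g₃ i = 6) ∧ (∀ i, g₁ i ≤ 4 ∧ g₂ i ≤ 4 ∧ g₃ i ≤ 4) ∧
     (∀ s ∈ S, (∃ i, s i < g₁ i) ∧ (∃ i, s i < g₂ i) ∧ (∃ i, s i < g₃ i)) ∧
     (∀ i, g₁ i + g₂ i + g₃ i = (![4, 4, 1, 1, 1, 1] : Fin 6 → ℕ) i + if i = 2 then 6 else 0)) ∧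
    -- case 3: S = {c, c'}, target c + 6e₀
    (let g₁ : Fin 6 → ℕ := ![1, 0, 0, 1, 1, 3]; let g₂ : Fin 6 → ℕ := ![1, 2, 1, 2, 0, 0]; let g₃ : Fin 6 → ℕ := ![4, 2, 0, 0, 0, 0]
     let S : List (Fin 6 → ℕ) := [![0, 4, 1, 3, 1, 3], ![4, 0, 3, 1, 3, 1]]
     (∑ i, g₁ i = 6 ∧ ∑ i, g₂ i = 6 ∧ ∑ i, g₃ i = 6) ∧ (∀ i, g₁ i ≤ 4 ∧ g₂ i ≤ 4 ∧ g₃ i ≤ 4) ∧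
     (∀ s ∈ S, (∃ i, s i < g₁ i) ∧ (∃ i, s i < g₂ i) ∧ (∃ i, s i < g₃ i)) ∧
     (∀ i, g₁ i + g₂ i + g₃ i = (![0, 4, 1, 3, 1, 3] : Fin 6 → ℕ) i + if i = 0 then 6 else 0)) ∧
    -- the carried exponents are in [5,10] and give non-zero Griffiths–Dwork constants (6-5)/18, (7-5)/18
    (5 ≤ 6 ∧ 6 ≤ 10 ∧ 5 ≤ 7 ∧ 7 ≤ 10 ∧ ((6 : ℚ) - 5) / 18 ≠ 0 ∧ ((7 : ℚ) - 5) / 18 ≠ 0) := by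
  refine ⟨by native_decide, by native_decide, by native_decide, ⟨by decide, by decide, by decide, by decide, by norm_num, by norm_num⟩⟩

/-! #### Not re-checked in Lean (exhaustive enumerations; kit-certified by `comp/verify_kill.py` (V1)–(V3), an independent
re-implementation, and by `comp/lambda_search3.py` / `certify_slice.py`):
(census) the admissible characters of `a + Λ₁` by type are `18 × (2,2)`, `1 × (3,1)` (`= 2a`), `1 × (1,3)` (`= 4a`), none of type
`(4,0)/(0,4)` — so `F³` of the isotypic piece has rank one and ONE equation cuts `Z` out of `𝓕_D`, with linear part supported on the
single direction `(3,3,0,0,0,0)` (`kill_class_data`); (completeness) `killD` is all of `Λ₁ ∩ R₆`; (confinement) every `β ∈ R₁₂` other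
than `b, b', c, c'` has `β + γ ≤ 4` or `(4 − β) + γ ≤ 4` for some `γ ∈ killDfree` — 48 survivors, paired survivors exactly
`{b, b', c, c'}` (`kill_survivors` is the converse half). A `decide`/`native_decide` transcription over `[0,5]⁶` is routine but exceeds
the farm's per-file budget in the naive encoding; it is left to whoever types the crux. -/

end CycleThree_Kill


section CycleFour_Review

/-! ### §H6 (cycle 4) KILL RE-VERIFIED; CERTIFICATE COMPLETED; CLASSIFICATION AND THE REPAIRED STATEMENT `C′`

(1) `KILL.md` was re-derived line by line by an independent seat (`KILL-REVIEW.md`, attached as item evidence): the refutation of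
P2a AS FILED stands. Three clarifications, none a gap: (R1) only the relations `ρ ∈ T(P_v)` with reduced support are used in
the `T²` criterion — a subset of all relations, giving valid necessary conditions; (R2) read `𝒵 := e_π𝒵` in §4 (`e_π` is a
`ℚ`-combination of automorphisms, so `u` is the class of a `ℚ`-cycle and its own Hodge locus is `Z`); (R3) the cycle exists by
Shioda's inductive structure alone: `a = (1,1,4) ∗ (4,4,4)` is the type-∗ image of a DIVISOR class on the product of two
Fermat sextic CURVES (`(1,1,4)` of type `(1,0)`, `(4,4,4) = 4·(1,1,4)` of type `(0,1)`; the class of the graph of an isogeny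
between the CM elliptic quotients `E_{[(1,1,4)]}` and `E_{[(2,2,2)]}`, both CM by `ℚ(√−3)`), so `u` is carried by a surface
RULED over the graph of a CM isogeny — `review_inductive_character`; the Hodge conjecture for `X⁴₆` (Shioda, `m ≤ 20`;
da Silva arXiv:2101.04739 Thm 2.7) is not needed. By §H2 (e) that ruled surface's class is a PURE pair class mod `h²`, so
neither `𝒪_{Z_u}`, `𝓘_{Z_u}` nor any sheaf with that `ch₂` is semiregular, in any characteristic `≠ 2, 3, 5`.
(2) The finite certificate is now COMPLETE and kernel-checked in the Negative file (proposed `--supports` this item; proposal id on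
the item / in the disprover's NOTES) `Theorems/SemiregularSeedsOnAnchors/Negative/SexticSliceCertificate.lean` (namespace `…Negative.SexticSlice`, plain `List ℕ`
encoding, `native_decide`; the `Fin 6 → Fin 6`/`![…]` encoding of §H5 evaluates ~10⁵× slower on the farm, which is why §H5
left the enumerations to kit): `card_lam` (`|Λ₁| = 162` of `46656`), `inLam_add`, `lam_census` (18/1/1/0 — ONE equation),
`killD_complete` (exhaustive over `[0,4]⁶`), `kill_equation_direction`, `kill_confinement` (`48` survivors of `1751`, paired
survivors EXACTLY `b, c, c', b'`), `kill_witnesses`, `kill_witness_counts` (`372 / 35 / 621` witness triples available; tangent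
sizes `314 / 244 / 318`), and — NEW — a SECOND INDEPENDENT SLICE `Λ₂ = ⟨(2,0,2,2,0,0),(0,0,0,2,4,0),(1,3,0,0,2,0),(0,2,0,2,0,2)⟩`
(`card_lam₂`, `lam₂_census` 22/2/2/0: TWO equations with independent linear parts on `(0,0,2,2,2,0)` and `(3,3,0,0,0,0)`,
`killD₂_complete` (`|D₂| = 25`, `dim Z₂ = 23`), `kill_confinement₂`: `59` survivors, paired part EXACTLY `{b, b'}`) at whose very
general points only cases 2 and 4 of KILL.md (K3) occur — the refutation has two independent instances and does not depend on the
`{c, c'}` bookkeeping. Independent python recounts: `comp/recheck_kill.py`, `comp/slice2.py` (attached).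
(3) CLASSIFICATION (for the planner's repair mode). The witness anchor is of the FILED kind and of the kind the route wants for
`HodgeBeyondAnchors` ("supersingular points on Hodge loci") — for that programme the kill is substantive. But the Assembly consumes
P2a only at (A) ABELIAN-SCHEME anchors at ℚ̄-generic points of special subvarieties (P2b (B1), for `HodgeAbelianVarieties`) and
(F) the FERMAT LIFTS `X^n_m ⊗ W` themselves, `p^ν ≡ −1 (m)` (P2b (B2), for `HodgeFermatVarieties`). The minimal repair is typed
below: `SemiregularSeedsOnRestrictedAnchors` = the crux with `IsPadicAnchor` strengthened to `IsRestrictedAnchor` (abelian scheme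
∨ Fermat lift); `semiregularSeedsOnRestrictedAnchors_of` records that it is WEAKER than the crux. THE WITNESS MISSES `C′`: at (F)
there is no positive-dimensional slice, hence no confinement, and seeds with broad, partly invisible support evade every
second-order argument (the monomial tangent space of a broad support is empty); at (A) special subvarieties are smooth, so the
second-order obstruction is void, and `HT² ≠ H¹(T)` so `ev` onto is not implied by semiregularity — confinement alone reproduces
g2's consistent forced family `Φ_ℚ`. Hence, by the refuter's rule, the repair-mode token is refuted-MISSTATED (over-broad anchor
class; `C′` written and missed), with the rider that `C′` is OPEN (it is the crux's real content: every positive instance found in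
four cycles — plane bundles at cubic/quartic Fermat fourfolds, exceptional bundles, trace-rigid objects — lives inside `C′`) and
that KILL.md §6 (iii) is imprecise ((F) IS the CM lift and is what P2b (B2) supplies; (A) is no CM restriction).
Recommended restatement: split P2a into `SemiregularSeedsOnAbelianAnchors` (A) and `SemiregularSeedsOnFermatLifts` (F); drop
"supersingular points on Hodge loci" as the access route of `HodgeBeyondAnchors`. Barrier candidate: second-order Hodge-locus
obstruction at CM hypersurface points + confinement on symmetric slices (KILL-REVIEW §3).
(4) NEW NEGATIVE KNOWLEDGE INSIDE `C′`-(F) (the Fermat sextic LIFT itself, where the kill does not reach; `comp/full_second_order.py`,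
`plane_plus_pair.py`, `planes_multi.py`, exact arithmetic mod `q = 1000081 ≡ 1 (12)`, attached): the FULL second-order test (kernel
basis of `m_P` + the trilinear form `Φ` on dense random tangent triples; CONTROL reproduced independently of g3's scripts: the plane
class — both phase conventions, and with phases `(1,2,3)` — has `dim T = 407 = 426 − 19` and `Φ ≡ 0`; two planes of one pairing:
`dim T = 394`, `Φ ≡ 0`) finds `Φ ≢ 0` — OBSTRUCTED — for every tested class `v = (linear-cycle classes) + λ·u`, `u` the unsaturated
pure pair class, `λ ≠ 0`, coefficients generic: plane `+ λu` (`dim T = 297`), two planes `+ λu` (`284`), a plane of another pairing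
`+ λu` (`295`), three planes of the three pairings `+ λu` (`259`); and a random-coefficient support of three pairs containing
`{b,b'}` (`dim T = 142 > 98 =` its monomial part) is obstructed although it passes the MONOMIAL-triple test — the non-monomial
tangent directions matter. By §H2 (e): outside a proper Zariski-closed set of coefficient vectors on each of these supports, NO
semiregular sheaf or perfect complex on the Fermat sextic fourfold (char `0` or `≥ 11`) has such a `ch₂ (mod h²)` — "reach the
unsaturated pair by decorating plane bundles" is dead generically; a seed for `u` at the Fermat lift needs a broad, specially
phased support of a kind not yet seen (`fermatLift_secondOrder_dims`). This sharpens, but does not settle, `C′`-(F) at `m = 6`. -/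

namespace Repair

open CategoryTheory AlgebraicGeometry
open Literature.AlgebraicGeometry.Motives Literature.AlgebraicGeometry.Motives.WittScheme
open Literature.AlgebraicGeometry.HodgeTheory
open Summit.HodgeConjecture.HodgeConjecture.Cruxes.SemiregularSeedsOnAnchors

variable {p : ℕ} [Fact p.Prime] {k : Type u} [Field k] [CharP k p] [PerfectRing k p]

/-- `𝒳 ≅ V₊(x₀ᵐ + ⋯ + x_{n+1}ᵐ) ⊂ ℙ^{n+1}_W`, `W = W(k)`: the FERMAT LIFT (the anchor P2b (B2) supplies; shape of the tree's
`IsFermatVariety` / `IsHypersurfaceCutOutBy` over the ring `W`, via `Crystalline.projectiveSpaceOver`). -/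
def IsFermatLift (n m : ℕ) (𝒳 : SchemeOver (WittVector p k)) : Prop :=
  letI := MvPolynomial.gradedAlgebra (σ := Fin (n + 2)) (R := WittVector p k)
  ∃ ι : 𝒳 ⟶ Literature.AlgebraicGeometry.Crystalline.projectiveSpaceOver (n + 1) (WittVector p k),
    IsClosedImmersion ι.left ∧
      Set.range ι.left.base =
        ProjectiveSpectrum.zeroLocus (MvPolynomial.homogeneousSubmodule (Fin (n + 2)) (WittVector p k))
          {∑ i : Fin (n + 2), MvPolynomial.X i ^ m}

/-- **Restricted anchor** (the repair `C′`): a p-adic anchor of the filed kind which is moreover (A) an ABELIAN SCHEME over `W`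
(a group-object structure on the smooth proper `W`-scheme with geometrically integral fibres) or (F) a FERMAT LIFT `X^n_m ⊗ W`
with `m ≥ 2`, `m ∣ p^ν + 1` for some `ν ≥ 1` (Shioda–Katsura supersingularity of the special fibre). These are exactly the two
anchor classes the Assembly consumes (`HodgeAbelianVarieties` via P2b (B1), `HodgeFermatVarieties` via P2b (B2)). -/
def IsRestrictedAnchor (C : CrystallineRealization p k) (n : ℕ) (𝒳 : SchemeOver (WittVector p k)) : Prop :=
  IsPadicAnchor C n 𝒳 ∧
    (Nonempty (GrpObj 𝒳) ∨ ∃ m ν : ℕ, 2 ≤ m ∧ 1 ≤ ν ∧ m ∣ p ^ ν + 1 ∧ IsFermatLift n m 𝒳)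

/-- **`C′ = SemiregularSeedsOnRestrictedAnchors`**: the typed crux verbatim with `IsPadicAnchor` replaced by
`IsRestrictedAnchor`. The cycle-3 witness (a very general point of a Hodge-locus slice through the Fermat sextic; neither an
abelian scheme nor a Fermat lift) does not bite it; its truth is open. -/
def SemiregularSeedsOnRestrictedAnchors [IsAlgClosed k] (C : CrystallineRealization p k) (Θ : HigherSigma k)
    (HO : ∀ ⦃𝒳 : SchemeOver (WittVector p k)⦄ ⦃i : ℕ⦄, C.dR.obj (genericFibre 𝒳) i → Prop) : Prop :=
  ∀ (n : ℕ) (𝒳 : SchemeOver (WittVector p k)), IsRestrictedAnchor C n 𝒳 →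
    ∀ (r : ℕ) (α : C.dR.obj (genericFibre 𝒳) (2 * r)),
      α ∈ C.dR.fil (2 * r) r →
      (∃ x ∈ C.tateClasses (specialFibre 𝒳) r, C.bo 𝒳 (2 * r) x = α) →
      HO α →
      SeedSpan C Θ 𝒳 r α

/-- `C′` is a weakening of the typed crux (so every line concluding the crux concludes `C′`, and the planner may restate to `C′`
without losing any positive work). [folklore] -/
theorem semiregularSeedsOnRestrictedAnchors_of [IsAlgClosed k] (C : CrystallineRealization p k) (Θ : HigherSigma k)
    (HO : ∀ ⦃𝒳 : SchemeOver (WittVector p k)⦄ ⦃i : ℕ⦄, C.dR.obj (genericFibre 𝒳) i → Prop)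
    (h : SemiregularSeedsOnAnchors C Θ HO) : SemiregularSeedsOnRestrictedAnchors C Θ HO :=
  fun n 𝒳 h𝒳 r α hfil hT hHO => h n 𝒳 h𝒳.1 r α hfil hT hHO

/-- The two halves of `C′`, separately (the recommended restatement splits P2a by anchor class). -/
def SemiregularSeedsOnAbelianAnchors [IsAlgClosed k] (C : CrystallineRealization p k) (Θ : HigherSigma k)
    (HO : ∀ ⦃𝒳 : SchemeOver (WittVector p k)⦄ ⦃i : ℕ⦄, C.dR.obj (genericFibre 𝒳) i → Prop) : Prop :=
  ∀ (n : ℕ) (𝒳 : SchemeOver (WittVector p k)), IsPadicAnchor C n 𝒳 → Nonempty (GrpObj 𝒳) →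
    ∀ (r : ℕ) (α : C.dR.obj (genericFibre 𝒳) (2 * r)),
      α ∈ C.dR.fil (2 * r) r →
      (∃ x ∈ C.tateClasses (specialFibre 𝒳) r, C.bo 𝒳 (2 * r) x = α) →
      HO α →
      SeedSpan C Θ 𝒳 r α

def SemiregularSeedsOnFermatLifts [IsAlgClosed k] (C : CrystallineRealization p k) (Θ : HigherSigma k)
    (HO : ∀ ⦃𝒳 : SchemeOver (WittVector p k)⦄ ⦃i : ℕ⦄, C.dR.obj (genericFibre 𝒳) i → Prop) : Prop :=
  ∀ (n : ℕ) (𝒳 : SchemeOver (WittVector p k)), IsPadicAnchor C n 𝒳 →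
    (∃ m ν : ℕ, 2 ≤ m ∧ 1 ≤ ν ∧ m ∣ p ^ ν + 1 ∧ IsFermatLift n m 𝒳) →
    ∀ (r : ℕ) (α : C.dR.obj (genericFibre 𝒳) (2 * r)),
      α ∈ C.dR.fil (2 * r) r →
      (∃ x ∈ C.tateClasses (specialFibre 𝒳) r, C.bo 𝒳 (2 * r) x = α) →
      HO α →
      SeedSpan C Θ 𝒳 r α

/-- `C′ ↔ (A-half) ∧ (F-half)`. [folklore] -/
theorem semiregularSeedsOnRestrictedAnchors_iff [IsAlgClosed k] (C : CrystallineRealization p k) (Θ : HigherSigma k)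
    (HO : ∀ ⦃𝒳 : SchemeOver (WittVector p k)⦄ ⦃i : ℕ⦄, C.dR.obj (genericFibre 𝒳) i → Prop) :
    SemiregularSeedsOnRestrictedAnchors C Θ HO ↔
      SemiregularSeedsOnAbelianAnchors C Θ HO ∧ SemiregularSeedsOnFermatLifts C Θ HO := by
  constructor
  · intro h
    exact ⟨fun n 𝒳 h𝒳 hG => h n 𝒳 ⟨h𝒳, Or.inl hG⟩, fun n 𝒳 h𝒳 hF => h n 𝒳 ⟨h𝒳, Or.inr hF⟩⟩
  · rintro ⟨hA, hF⟩ n 𝒳 ⟨h𝒳, hG | hFl⟩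
    · exact hA n 𝒳 h𝒳 hG
    · exact hF n 𝒳 h𝒳 hFl

end Repair

/-- (R3) The character bookkeeping of the review: `a = (1,1,4,4,4,4)` is the concatenation `(1,1,4) ∗ (4,4,4)` of two characters
of the Fermat sextic CURVE (`Σ ≡ 0 (mod 6)` blockwise), of Hodge types `(1,0)` (`Σ/6 = 1`) and `(0,1)` (`Σ/6 = 2`), so under
Shioda's type-∗ inductive structure `X¹₆ × X¹₆ → X⁴₆` (twist `(−1)`) it is the image of a `(1,1)`-class on the product of two
curves — a divisor class, algebraic by Lefschetz; and `(4,4,4) = 4·(1,1,4)`, `(2,2,2) = 2·(1,1,4)` (the divisor is the graph of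
an isogeny between the CM elliptic quotients attached to the orbits `{(1,1,4),(5,5,2)}` and `{(2,2,2),(4,4,4)}`). Alternatively
`a ~ (1,4,4,1,4,4) = (1,4,4,3) # (1,4,4,3)` (type #, `3 + 3 ≡ 0`) from two `(1,1)`-characters of the Fermat sextic SURFACE
(`Σ = 12`). Either way no appeal to HC(`X⁴₆`) is needed for the cycle `𝒵` of KILL.md §1. -/
theorem review_inductive_character :
    ((1 + 1 + 4) % 6 = 0 ∧ (4 + 4 + 4) % 6 = 0 ∧ (1 + 1 + 4) / 6 = 1 ∧ (4 + 4 + 4) / 6 = 2) ∧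
    ((4 * 1) % 6 = 4 ∧ (4 * 4) % 6 = 4 ∧ (2 * 1) % 6 = 2 ∧ (2 * 4) % 6 = 2) ∧
    ((1 + 4 + 4 + 3) % 6 = 0 ∧ (1 + 4 + 4 + 3) / 6 - 1 = 1 ∧ (3 + 3) % 6 = 0) ∧
    (1 + 1 + 4 + 4 + 4 + 4 = 18 ∧ 18 / 6 - 1 = 2) := by
  decide

/-- (3) Why the witness misses the (A)-half structurally: on an abelian `n`-fold the semiregularity target
`τ = Σ_q h^{q,q+2}` and `dim HT² = h^{0,2} + h^{1,1}·… ` — concretely for `n = 4`: `HT²(X) = H²(𝒪) ⊕ H¹(T) ⊕ H⁰(Λ²T)` has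
dimension `6 + 16 + 6 = 28 = τ` but its COMMUTATIVE part `H¹(T)` has dimension `16 < 28`, so `σ` injective (⇔ `ev²` onto, Lemma
B) does not make `ev = ev²|_{H¹(T)}` onto, and the order-two lifting (F2) — which re-chooses the ambient SCHEME — is unavailable;
on the CY sextic `HT² = H¹(T)` (`0 + 426 + 0`). [folklore] -/
theorem abelianFourfold_commutative_deficit :
    Nat.choose 4 2 * Nat.choose 4 0 + Nat.choose 4 1 * Nat.choose 4 1 + Nat.choose 4 0 * Nat.choose 4 2 = 28 ∧
    Nat.choose 4 1 * Nat.choose 4 1 = 16 ∧ 16 < 28 ∧ 0 + 426 + 0 = 426 := by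
  decide

/-- (4) The tangent-space dimensions of the cycle-4 second-order census at the Fermat sextic point (`q = 1000081`, the first prime
`≡ 1 (mod 12)` above `10⁶ + 80`, so that `ζ₁₂ ∈ 𝔽_q`): plane `407 = 426 − 19` (control: `ρ(plane) = h¹(N_{P/X}) = 19`, unobstructed),
two planes `394` (unobstructed), plane `+ λu` `297`, two planes `+ λu` `284`, other-pairing plane `+ λu` `295`, three planes `+ λu`
`259`, three-pair random support `142` vs its `98` monomials — all five `+ λu` / random classes OBSTRUCTED. The plane support is the
`125 = 5³` monomials `(i, 4−i, j, 4−j, l, 4−l)`. [computation: comp/planes_multi.py, plane_plus_pair.py] -/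
theorem fermatLift_secondOrder_dims :
    1000081 % 12 = 1 ∧ 426 - 19 = 407 ∧ 5 ^ 3 = 125 ∧ 394 < 407 ∧ 297 < 407 ∧ 284 < 297 ∧ 259 < 284 ∧ 98 < 142 ∧
    (∀ i j l : Fin 5, (i : ℕ) + (4 - i) + j + (4 - j) + l + (4 - l) = 12) := by
  refine ⟨by decide, by decide, by decide, by decide, by decide, by decide, by decide, by decide, ?_⟩
  intro i j l
  have hi := i.isLt; have hj := j.isLt; have hl := l.isLt
  omega

end CycleFour_Review

end Summit.HodgeConjecture.HodgeConjecture.Cruxes.SemiregularSeedsOnAnchors.Disproof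

end
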